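import Literature.Topology.FourManifolds.IntersectionLattice
import Literature.Topology.FourManifolds.SmoothOrientationProofs
import Literature.AlgebraicTopology.SingularHomology.LocalHomologyUniverse
import Literature.AlgebraicTopology.SingularHomology.LocalHomologyCharts
import Literature.AlgebraicTopology.SingularHomology.BoundaryTransfer
import Literature.AlgebraicTopology.SingularHomology.RelativeHomotopyInvariance
import Mathlib.LinearAlgebra.Matrix.Transvection
import Mathlib.LinearAlgebra.Matrix.Permutation
import Mathlib.Topology.Instances.Matrix
import Mathlib.Analysis.InnerProductSpace.PiL2
import HarnessLib

/-!
# Smoothly orientable manifolds are `ℤ`-orientable (proofs)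

Sibling proof file of `IntersectionLattice.lean` (next to `IntersectionLatticeProofs.lean`, which
discharges the intersection-form facts of that file and has disjoint, lighter prerequisites): it
DISCHARGES the named fact `Literature.Topology.FourManifolds.isOrientableOver_int_of_isOrientable`
(`theorem isOrientableOver_int_of_isOrientable_holds`, last section): a `C¹` manifold `X`
(charted on `ℝⁿ = EuclideanSpace ℝ (Fin n)`, `IsManifold (𝓡 n) 1 X`, not necessarily Hausdorff,
any universe, any `n`) carrying a smooth orientation `o : SmoothOrientation (𝓡 n) X` (G18: an orientation of the model
space at each point, read in the preferred chart, with `o y = o x` near `x` iff the coordinate change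
has positive Jacobian) carries a homological `ℤ`-orientation (G04: locally consistent generators
`μ_y ∈ Hₙ(X | y; ℤ)`).

Sources: G. E. Bredon, *Topology and Geometry*, GTM 139 (1993), §VI.7 (orientation of smooth vs
topological manifolds; Prop. 7.14, Thm. 7.15); J. W. Milnor, J. D. Stasheff, *Characteristic
Classes* (1974), Appendix A (the local orientation `μₓ ∈ Hₙ(M, M - x; ℤ)` attached to an
orientation of the tangent bundle); A. Hatcher, *Algebraic Topology* (2002), §2.1 Prop. 2.19,
Thm. 2.20, §3.3 pp. 231–237 (local homology, orientations), whose statements are the tree's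
`Literature.AlgebraicTopology.SingularHomology.*` theorems used throughout.

## The proof

The classical argument ("a positively oriented chart identifies `Hₙ(M | x)` with
`Hₙ(ℝⁿ | p) = ℤ`, and positively related charts induce the same identification because an
orientation-preserving diffeomorphism of `ℝⁿ` has local degree `+1`") is carried out as follows;
everything is proved here, on the tree's singular homology, and no new named fact is introduced.

1. **Reference orientation of `ℝⁿ`** (`μE`): the restriction `Hₙ(ℝⁿ | B(0, ρ)) → Hₙ(ℝⁿ | y)` is an
   isomorphism for every `y` in the ball (tree: star-convex chart pieces), so a chosen generator at
   the origin spreads to compatible *ball classes* and to a `HomologicalOrientation ℤ (𝔼 n) n`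
   represented on every ball about `0`.
2. **Preservation** (`Pres μ e`): a homeomorphism `e` preserves `μ` if `e_* μ_y = μ_{e y}` for all
   `y` (stated with a free target point and a map-of-pairs hypothesis); equivalently
   `μ.comap e = μ`. Translations preserve `μE` (straight-line homotopy of maps of pairs
   `(ℝⁿ, ℝⁿ ∖ B) → (ℝⁿ, ℝⁿ ∖ (y + v))` and homotopy invariance, Hatcher Prop. 2.19).
3. **Linear maps of positive determinant preserve `μE`** — WITHOUT computing the degree of a
   reflection: the sign `χ(e) ∈ {±1}` of a homeomorphism on `μE` (`μE.comap e = ±μE`, `ℝⁿ` being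
   connected: tree, Hatcher p. 234) is multiplicative; a matrix joined to `1` by a path of
   invertible matrices acts as the identity on `Hₙ(ℝⁿ | 0)` (homotopy invariance) hence has sign `1`
   (orientations agreeing at a point agree, tree); by Mathlib's
   `Matrix.diagonal_transvection_induction_of_det_ne_zero` every invertible matrix has the sign of
   `diag(det, 1, …, 1)` (transvections are joined to `1`; a diagonal entry is moved to the first slot
   by conjugating with a transposition, which does not change the sign in the abelian group `ℤˣ`,
   and entries in the same slot multiply), and `diag(d, 1, …, 1)`, `d > 0`, is joined to `1`.
   Hence affine maps with positive linear part preserve `μE` (`pres_of_affine`).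
4. **Linearization** (`map_ballMap_eq`): if `G` is continuous and injective on an open `W ∋ p` and
   differentiable at `p` with injective derivative `A`, the difference quotients
   `(s, z) ↦ G p + s⁻¹ (G (p + s (z - p)) - G p)` (`s = 0`: `G p + A (z - p)`) form a homotopy of maps
   of pairs `(B, B ∖ p) → (ℝⁿ, ℝⁿ ∖ G p)` on a small ball `B`, so `G` and its affine approximation
   induce the same map `Hₙ(B | p) → Hₙ(ℝⁿ | G p)`; through the excision isomorphisms
   (`openSubsetIso_map_eq_map_affine`) a local homeomorphism `g₀ : W → W'` acts on
   `Hₙ(ℝⁿ | p) → Hₙ(ℝⁿ | G p)` as its affine approximation.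
5. **Oriented charts** (`Rh`, `μR`, `localClassX`): at `y` use the preferred chart `c_y` followed by
   `R_y =` the identity if `o y` is the standard orientation of `ℝⁿ` and by the reflection
   `r = diag(-1, 1, …, 1)` otherwise; `μ_y :=` the class corresponding, under excision and the
   cross-universe transport along `c_y` (`chartTransport`, the tree's `xEquiv`), to the local class
   at `c_y y` of `μE.comap R_y`. The affine approximation of the chart change, conjugated by `R_x`,
   `R_y`, has linear part `R_y ∘ D(c_y ∘ c_x⁻¹) ∘ R_x`, of positive determinant near `x` by the
   defining property of `o` and a four-case sign count (`det_pos_of_iff`; only `det r = -1` for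
   `n ≥ 1` and `r ∘ r = id` are used), so it carries `μE.comap R_x` to `μE.comap R_y`
   (`map_affineApprox_comap`, `chartTransport_symm_μR`).
6. **Local consistency** (`locallyConsistent_localClassX`): the ball class of `μE.comap R_x` on a
   small closed chart ball about `c_x x` is carried to a class on a neighbourhood of `x` in `X`
   (excision at a set in `ℝⁿ`, transport, then the plain map induced by `U ⊆ X`), whose point
   restrictions are the classes built from the chart at `x`; by 5. these are the `μ_y`.

## Design notes

* All induced maps on local homology at points are the tree's
  `relativeSingularHomology.map ℤ ℤ f (h : MapsTo f {a}ᶜ {b}ᶜ) k` with a *free* target point `b`,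
  which avoids transport along equalities of base points.
* The fact's `def` takes only `[TopologicalSpace X] [ChartedSpace (𝔼 n) X] [IsManifold (𝓡 n) 1 X]`
  (the `[T2Space X] [SecondCountableTopology X]` of its section are unused by it); the discharge has
  exactly these binders. On `X` the proof uses only the `T₁` property of charted spaces over `ℝⁿ`
  (`ChartedSpace.t1Space`); the tree's Hausdorff-only results (star-convex chart pieces,
  `Hₙ(X | x) ≃ ℤ`, two orientations of a connected manifold) are applied to `ℝⁿ` only.
* No `sorry`, no new axioms, no new named facts; the only new definitions are the auxiliary objects
  of the proof (namespace `HomologicalOrientationOfSmooth`).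
-/

noncomputable section

open CategoryTheory Set Metric Filter Function
open scoped unitInterval
open Literature.AlgebraicTopology.SingularHomology

universe u

namespace Literature.Topology.FourManifolds

open scoped _root_.Topology _root_.Manifold

/-- Local notation: `𝔼 n` is the model Euclidean space `EuclideanSpace ℝ (Fin n)`. -/
local notation "𝔼 " n:arg => EuclideanSpace ℝ (Fin n)

namespace HomologicalOrientationOfSmooth

variable {n : ℕ}

/-! ### The reference `ℤ`-orientation of `ℝⁿ` -/

/-- On `ℝⁿ`, the restriction `Hᵢ(ℝⁿ | B) ⟶ Hᵢ(ℝⁿ | y)` from an open ball `B` about the origin to any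
of its points is an isomorphism (Hatcher 2002, §3.3, p. 237: "the map `Hᵢ(ℝⁿ | A) → Hᵢ(ℝⁿ | x)` is
an isomorphism for any `x ∈ A`" when `A` is convex; the tree's
`isIso_restrictToPoint_of_starConvex_chart` in the identity chart).
[cite: HatcherAT2002, §3.3 p. 237] -/
theorem isIso_restrictToPoint_ball {ρ : ℝ} {y : 𝔼 n} (hy : y ∈ ball (0 : 𝔼 n) ρ) (i : ℕ) :
    IsIso (restrictToPoint ℤ ℤ hy i) := by
  have hρ : 0 < ρ := pos_of_mem_ball hy
  refine isIso_restrictToPoint_of_starConvex_chart ℤ ℤ (OpenPartialHomeomorph.refl (𝔼 n))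
    (x := y) (mem_univ y) (ρ := 2 * ρ) (by positivity) (subset_univ _)
    ((convex_ball (0 : 𝔼 n) ρ).starConvex hy) hy ?_ ?_ hy i
  · intro v hv
    simp only [OpenPartialHomeomorph.refl_apply, mem_ball] at hv hy ⊢
    calc dist v y ≤ dist v 0 + dist 0 y := dist_triangle _ _ _
      _ < ρ + ρ := add_lt_add hv (by rwa [dist_comm])
      _ = 2 * ρ := by ring
  · ext v
    simp

variable (n) in
/-- A chosen identification `Hₙ(ℝⁿ | 0; ℤ) ≃ ℤ` (Hatcher 2002, §3.3, p. 231: `Hₙ(ℝⁿ | 0) ≅ ℤ`; the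
tree's `localHomology.nonempty_linearEquiv`). [cite: HatcherAT2002, §3.3 p. 231] -/
def genEquiv : localHomology ℤ ℤ (𝔼 n) (0 : 𝔼 n) n ≃ₗ[ℤ] ℤ :=
  Classical.choice (localHomology.nonempty_linearEquiv ℤ (0 : 𝔼 n))

variable (n) in
/-- The reference generator of `Hₙ(ℝⁿ | 0; ℤ)`. [folklore] -/
def gen0 : localHomology ℤ ℤ (𝔼 n) (0 : 𝔼 n) n :=
  (genEquiv n).symm 1

/-- `genEquiv (gen0) = 1`. [folklore] -/
@[simp] theorem genEquiv_gen0 : genEquiv n (gen0 n) = 1 :=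
  (genEquiv n).apply_symm_apply 1

variable (n) in
/-- The class on the open ball `B(0, ρ)` restricting to the reference generator at the origin
(Hatcher 2002, §3.3, p. 234: the classes `μ_B`). [folklore] -/
def ballClass {ρ : ℝ} (hρ : 0 < ρ) : localHomologyOfSet ℤ ℤ (𝔼 n) (ball (0 : 𝔼 n) ρ) n :=
  haveI := isIso_restrictToPoint_ball (n := n) (mem_ball_self (x := (0 : 𝔼 n)) hρ) n
  inv (restrictToPoint ℤ ℤ (mem_ball_self (x := (0 : 𝔼 n)) hρ) n) (gen0 n)

/-- The ball class restricts to the reference generator at the origin. [folklore] -/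
theorem restrictToPoint_zero_ballClass {ρ : ℝ} (hρ : 0 < ρ) :
    restrictToPoint ℤ ℤ (mem_ball_self (x := (0 : 𝔼 n)) hρ) n (ballClass n hρ) = gen0 n := by
  haveI := isIso_restrictToPoint_ball (n := n) (mem_ball_self (x := (0 : 𝔼 n)) hρ) n
  exact IsIso.inv_hom_id_apply (C := ModuleCat ℤ) _ _

/-- The ball classes are compatible under restriction to smaller balls. [folklore] -/
theorem restrictLocal_ballClass {ρ ρ' : ℝ} (hρ : 0 < ρ) (h : ρ ≤ ρ') :
    restrictLocal ℤ ℤ (ball_subset_ball h) n (ballClass n (hρ.trans_le h)) = ballClass n hρ := by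
  haveI := isIso_restrictToPoint_ball (n := n) (mem_ball_self (x := (0 : 𝔼 n)) hρ) n
  apply (ModuleCat.mono_iff_injective
    (restrictToPoint ℤ ℤ (mem_ball_self (x := (0 : 𝔼 n)) hρ) n)).1 inferInstance
  rw [restrictToPoint_restrictLocal_apply]
  exact (restrictToPoint_zero_ballClass (hρ.trans_le h)).trans
    (restrictToPoint_zero_ballClass hρ).symm

/-- Restricting two ball classes to a common point gives the same local class. [folklore] -/
theorem restrictToPoint_ballClass_eq {ρ ρ' : ℝ} {y : 𝔼 n} (hy : y ∈ ball (0 : 𝔼 n) ρ)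
    (hy' : y ∈ ball (0 : 𝔼 n) ρ') :
    restrictToPoint ℤ ℤ hy n (ballClass n (pos_of_mem_ball hy)) =
      restrictToPoint ℤ ℤ hy' n (ballClass n (pos_of_mem_ball hy')) := by
  wlog h : ρ ≤ ρ' generalizing ρ ρ'
  · exact (this hy' hy (le_of_not_ge h)).symm
  rw [← restrictLocal_ballClass (pos_of_mem_ball hy) h, restrictToPoint_restrictLocal_apply]

/-- The local class of the reference orientation of `ℝⁿ` at `y`: the restriction of the ball class
of radius `‖y‖ + 1`. [folklore] -/
def localClassE (y : 𝔼 n) : localHomology ℤ ℤ (𝔼 n) y n :=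
  restrictToPoint ℤ ℤ (mem_ball_zero_iff.2 (lt_add_one ‖y‖)) n (ballClass n (by positivity))

/-- The local class at `y` is the restriction of *any* ball class about the origin containing `y`.
[folklore] -/
theorem localClassE_eq {ρ : ℝ} {y : 𝔼 n} (hy : y ∈ ball (0 : 𝔼 n) ρ) :
    localClassE y = restrictToPoint ℤ ℤ hy n (ballClass n (pos_of_mem_ball hy)) :=
  restrictToPoint_ballClass_eq _ hy

variable (n) in
/-- **The reference `ℤ`-orientation `μ_E` of `ℝⁿ`**: the locally (indeed, on every ball about the
origin) consistent family of generators obtained by restricting the ball classes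
(Hatcher 2002, §3.3, p. 234–235: `ℝⁿ` is orientable, an orientation being determined by a generator
of `Hₙ(ℝⁿ | 0)`). [cite: HatcherAT2002, §3.3 pp. 234–235] -/
def μE : HomologicalOrientation ℤ (𝔼 n) n where
  localClass := localClassE
  isGenerator y := by
    haveI := isIso_restrictToPoint_ball (n := n) (mem_ball_zero_iff.2 (lt_add_one ‖y‖)) n
    refine (isGenerator_iff_of_isIso ℤ (restrictToPoint ℤ ℤ
      (mem_ball_zero_iff.2 (lt_add_one ‖y‖)) n) _).2 ?_
    haveI := isIso_restrictToPoint_ball (n := n)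
      (mem_ball_self (x := (0 : 𝔼 n)) (by positivity : (0 : ℝ) < ‖y‖ + 1)) n
    exact (isGenerator_iff_of_isIso ℤ (inv (restrictToPoint ℤ ℤ
      (mem_ball_self (x := (0 : 𝔼 n)) (by positivity : (0 : ℝ) < ‖y‖ + 1)) n)) (gen0 n)).2
        ⟨genEquiv n, genEquiv_gen0⟩
  locallyConsistent y :=
    ⟨ball 0 (‖y‖ + 1), isOpen_ball.mem_nhds (mem_ball_zero_iff.2 (lt_add_one ‖y‖)),
      ballClass n (by positivity), fun _ hz ↦ (localClassE_eq hz).symm⟩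

/-- The local classes of `μ_E` are restrictions of the ball classes. [folklore] -/
theorem μE_localClass_eq {ρ : ℝ} {y : 𝔼 n} (hy : y ∈ ball (0 : 𝔼 n) ρ) :
    (μE n).localClass y = restrictToPoint ℤ ℤ hy n (ballClass n (pos_of_mem_ball hy)) :=
  localClassE_eq hy

/-! ### Induced maps on local homology at points: bookkeeping -/

section Bookkeeping

variable {X Y Z : Type u} [TopologicalSpace X] [TopologicalSpace Y] [TopologicalSpace Z]

omit [TopologicalSpace X] [TopologicalSpace Y] in
/-- An injective map sending `a` to `b` is a map of pairs `(X, X ∖ a) → (Y, Y ∖ b)`. [folklore] -/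
theorem mapsTo_compl_singleton_of_injective {f : X → Y} (hf : Injective f) {a : X} {b : Y}
    (h : f a = b) : MapsTo f ({a}ᶜ : Set X) ({b}ᶜ : Set Y) :=
  fun _ hx hfx ↦ hx (hf ((mem_singleton_iff.1 hfx).trans h.symm))

omit [TopologicalSpace X] [TopologicalSpace Y] in
/-- A surjective map of pairs `(X, X ∖ a) → (Y, Y ∖ b)` sends `a` to `b`. [folklore] -/
theorem eq_of_mapsTo_compl_singleton {f : X → Y} (hf : Surjective f) {a : X} {b : Y}
    (h : MapsTo f ({a}ᶜ : Set X) ({b}ᶜ : Set Y)) : f a = b := by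
  obtain ⟨x, rfl⟩ := hf b
  by_contra hne
  have hx : x ≠ a := fun hxa ↦ hne (hxa ▸ rfl)
  exact h hx rfl

/-- Equal maps of pairs induce equal maps on relative homology, whatever the two proofs of the
subspace condition. [folklore] -/
theorem map_congr_fun {S : Set X} {T : Set Y} {f f' : C(X, Y)} (e : f = f') (h : MapsTo f S T)
    (h' : MapsTo f' S T) (k : ℕ) :
    relativeSingularHomology.map ℤ ℤ f h k = relativeSingularHomology.map ℤ ℤ f' h' k := by
  subst e
  rfl

/-- `(g ∘ f)_* = g_* ∘ f_*` on local homology at points, elementwise. [folklore] -/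
theorem map_comp_apply {S : Set X} {T : Set Y} {U : Set Z} (f : C(X, Y)) (g : C(Y, Z))
    (hf : MapsTo f S T) (hg : MapsTo g T U) (hgf : MapsTo (g.comp f) S U) (k : ℕ)
    (z : relativeSingularHomology ℤ ℤ X S k) :
    relativeSingularHomology.map ℤ ℤ (g.comp f) hgf k z =
      relativeSingularHomology.map ℤ ℤ g hg k (relativeSingularHomology.map ℤ ℤ f hf k z) := by
  rw [← ModuleCat.comp_apply, ← relativeSingularHomology.map_comp]

end Bookkeeping

/-! ### Homeomorphisms preserving a homological orientation -/

section Pres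

variable {X : Type u} [TopologicalSpace X]

/-- A self-homeomorphism `e` of `X` **preserves** the `ℤ`-orientation `μ` if it carries each local
orientation class `μ_y` to `μ_{e y}` (Hatcher 2002, §3.3, p. 233 ff.: orientations are natural
under homeomorphisms; stated with a free target point `y'` and the condition that `e` is a map of
pairs `(X, X ∖ y) → (X, X ∖ y')`, which forces `y' = e y`). [folklore] -/
def Pres (μ : HomologicalOrientation ℤ X n) (e : X ≃ₜ X) : Prop :=
  ∀ ⦃y y' : X⦄ (h : MapsTo e ({y}ᶜ : Set X) {y'}ᶜ),
    relativeSingularHomology.map ℤ ℤ (e : C(X, X)) h n (μ.localClass y) = μ.localClass y'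

/-- `e` preserves `μ` iff the transported orientation `μ.comap e` is `μ`. [folklore] -/
theorem pres_iff_comap_eq {μ : HomologicalOrientation ℤ X n} {e : X ≃ₜ X} :
    Pres μ e ↔ μ.comap e = μ := by
  constructor
  · intro h
    ext1
    funext y
    rw [HomologicalOrientation.comap_localClass,
      ← h (mapsTo_compl_singleton_of_injective e.injective (rfl : e y = e y))]
    exact Iso.hom_inv_id_apply (localHomology.mapIso ℤ ℤ e y n) (μ.localClass y)
  · intro h y y' hy
    have hy' : e y = y' := eq_of_mapsTo_compl_singleton e.surjective hy
    subst hy'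
    have key := congrArg (fun ν : HomologicalOrientation ℤ X n ↦ ν.localClass y) h
    simp only [HomologicalOrientation.comap_localClass] at key
    rw [← key]
    exact Iso.inv_hom_id_apply (localHomology.mapIso ℤ ℤ e y n) _

/-- Preservation only depends on the underlying map. [folklore] -/
theorem pres_congr {μ : HomologicalOrientation ℤ X n} {e e' : X ≃ₜ X} (h : ∀ x, e x = e' x) :
    Pres μ e ↔ Pres μ e' := by
  obtain rfl : e = e' := Homeomorph.ext h
  exact Iff.rfl

/-- The identity preserves every orientation. [folklore] -/
theorem pres_refl (μ : HomologicalOrientation ℤ X n) : Pres μ (Homeomorph.refl X) := by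
  intro y y' h
  have hy' : y = y' := eq_of_mapsTo_compl_singleton surjective_id h
  subst hy'
  rw [map_congr_fun (Homeomorph.coe_refl (α := X)) h (mapsTo_id _) n,
    relativeSingularHomology.map_id]
  rfl

/-- Orientation-preserving homeomorphisms compose. [folklore] -/
theorem Pres.trans {μ : HomologicalOrientation ℤ X n} {e e' : X ≃ₜ X} (he : Pres μ e)
    (he' : Pres μ e') : Pres μ (e.trans e') := by
  intro y y'' h
  have h₁ : MapsTo e ({y}ᶜ : Set X) {e y}ᶜ := mapsTo_compl_singleton e.toEquiv y
  have h₂ : MapsTo e' ({e y}ᶜ : Set X) {y''}ᶜ := by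
    intro z hz hz'
    refine hz (mem_singleton_iff.2 ?_)
    have : (e.trans e') (e.symm z) = y'' := by simpa using hz'
    have hzy : e.symm z = y := by
      by_contra hne
      exact h hne this
    rw [← hzy, e.apply_symm_apply]
  rw [map_congr_fun (Homeomorph.coe_trans e e') h (h₂.comp h₁) n, map_comp_apply _ _ h₁ h₂,
    he h₁, he' h₂]

/-- The inverse of an orientation-preserving homeomorphism preserves the orientation. [folklore] -/
theorem Pres.symm {μ : HomologicalOrientation ℤ X n} {e : X ≃ₜ X} (he : Pres μ e) :
    Pres μ e.symm := by
  intro y y' h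
  have hy' : e.symm y = y' := eq_of_mapsTo_compl_singleton e.symm.surjective h
  subst hy'
  have h₁ : MapsTo e ({e.symm y}ᶜ : Set X) {y}ᶜ :=
    mapsTo_compl_singleton_of_injective e.injective (e.apply_symm_apply y)
  rw [← he h₁, ← map_comp_apply (e : C(X, X)) (e.symm : C(X, X)) h₁ h (h.comp h₁),
    map_congr_fun (Homeomorph.symm_comp_toContinuousMap e) (h.comp h₁) (mapsTo_id _) n,
    relativeSingularHomology.map_id]
  rfl

/-- Transport of the opposite orientation is the opposite of the transport. [folklore] -/
theorem comap_neg (μ : HomologicalOrientation ℤ X n) {Y : Type u} [TopologicalSpace Y]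
    (e : Y ≃ₜ X) : (-μ).comap e = -(μ.comap e) := by
  ext1
  funext y
  simp [HomologicalOrientation.comap_localClass, map_neg]

end Pres

/-! ### Translations preserve the reference orientation of `ℝⁿ` -/

/-- The straight-line homotopy `(s, z) ↦ z + s • v` from the identity to the translation by `v`.
[folklore] -/
def translationHomotopy (v : 𝔼 n) :
    ContinuousMap.Homotopy (ContinuousMap.id (𝔼 n)) (Homeomorph.addRight v : C(𝔼 n, 𝔼 n)) where
  toFun p := p.2 + (p.1 : ℝ) • v
  continuous_toFun := by fun_prop
  map_zero_left z := by simp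
  map_one_left z := by simp

/-- **Translations preserve `μ_E`**: `(τ_v)_* μ_y = μ_{y+v}`. On a ball `B` about the origin
containing the segment from `y` to `y + v`, the maps of pairs
`τ_{sv} : (ℝⁿ, ℝⁿ ∖ B) → (ℝⁿ, ℝⁿ ∖ (y+v))` form a homotopy from the identity to `τ_v`, so
`τ_v ∘ r_y = r_{y+v}` on `Hₙ(ℝⁿ | B)` by homotopy invariance (Hatcher 2002, Prop. 2.19), and both
restrictions of the ball class are local classes
of `μ_E`. [folklore] -/
theorem pres_addRight (v : 𝔼 n) : Pres (μE n) (Homeomorph.addRight v) := by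
  intro y y' h
  have hy' : y + v = y' := eq_of_mapsTo_compl_singleton (Homeomorph.addRight v).surjective h
  subst hy'
  set ρ : ℝ := ‖y‖ + ‖v‖ + 1 with hρ_def
  have hyC : y ∈ ball (0 : 𝔼 n) ρ := by
    rw [mem_ball_zero_iff, hρ_def]
    linarith [norm_nonneg v]
  have hyvC : y + v ∈ ball (0 : 𝔼 n) ρ := by
    rw [mem_ball_zero_iff, hρ_def]
    linarith [norm_add_le y v]
  have hF : ∀ p : I × 𝔼 n, p.2 ∈ (ball (0 : 𝔼 n) ρ)ᶜ →
      translationHomotopy v p ∈ ({y + v}ᶜ : Set (𝔼 n)) := by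
    rintro ⟨s, z⟩ hz hzv
    apply hz
    have hzv' : z + (s : ℝ) • v = y + v := hzv
    have hz' : z = y + (1 - (s : ℝ)) • v := by
      rw [sub_smul, one_smul, add_sub, ← hzv', add_sub_cancel_right]
    rw [mem_ball_zero_iff, hz', hρ_def]
    calc ‖y + (1 - (s : ℝ)) • v‖ ≤ ‖y‖ + ‖(1 - (s : ℝ)) • v‖ := norm_add_le _ _
      _ = ‖y‖ + (1 - (s : ℝ)) * ‖v‖ := by
        rw [norm_smul, Real.norm_of_nonneg (unitInterval.one_minus_nonneg s)]
      _ ≤ ‖y‖ + 1 * ‖v‖ := by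
        gcongr
        exact unitInterval.one_minus_le_one s
      _ < ‖y‖ + ‖v‖ + 1 := by linarith
  have hf : MapsTo (ContinuousMap.id (𝔼 n)) (ball (0 : 𝔼 n) ρ)ᶜ ({y + v}ᶜ : Set (𝔼 n)) :=
    fun z hz hzv ↦ hz (by have hz' : z = y + v := hzv; rw [hz']; exact hyvC)
  have hg : MapsTo (Homeomorph.addRight v : C(𝔼 n, 𝔼 n)) (ball (0 : 𝔼 n) ρ)ᶜ
      ({y + v}ᶜ : Set (𝔼 n)) := by
    intro z hz hzv
    apply hz
    have : z + v = y + v := hzv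
    rw [add_right_cancel this]
    exact hyC
  have key := relativeSingularHomology.map_eq_of_homotopic_holds ℤ ℤ hf hg
    (translationHomotopy v) hF n
  rw [μE_localClass_eq hyC, μE_localClass_eq hyvC, restrictToPoint, restrictLocal,
    ← map_comp_apply _ _ _ h hg]
  · rw [map_congr_fun (ContinuousMap.comp_id _) _ hg n, ← key]
    rfl

/-! ### The sign of a homeomorphism of a connected manifold on an orientation -/

section Sign

variable {X : Type u} [TopologicalSpace X] [T2Space X] [ChartedSpace (𝔼 n) X] [ConnectedSpace X]

/-- On a connected manifold a transported orientation is the original one or its opposite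
(Hatcher 2002, §3.3, p. 234: exactly two orientations; the tree's
`HomologicalOrientation.eq_or_eq_neg_of_connected_holds`). [cite: HatcherAT2002, §3.3 p. 234] -/
theorem comap_eq_or_eq_neg (μ : HomologicalOrientation ℤ X n) (e : X ≃ₜ X) :
    μ.comap e = μ ∨ μ.comap e = -μ :=
  HomologicalOrientation.eq_or_eq_neg_of_connected_holds X (μ.comap e) μ

omit [T2Space X] [ChartedSpace (𝔼 n) X] [ConnectedSpace X] in
/-- An orientation of a nonempty manifold differs from its opposite (a generator of an infinite
cyclic group is not its own negative). [folklore] -/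
theorem ne_neg_self [Nonempty X] (μ : HomologicalOrientation ℤ X n) : μ ≠ -μ := by
  intro h
  obtain ⟨x⟩ := ‹Nonempty X›
  obtain ⟨e, he⟩ := μ.isGenerator x
  have hx := congrArg (fun ν : HomologicalOrientation ℤ X n ↦ e (ν.localClass x)) h
  simp only [HomologicalOrientation.neg_localClass, map_neg, he] at hx
  omega

open Classical in
/-- The **sign** `χ_μ(e) ∈ {±1}` of a self-homeomorphism of a connected manifold on the
orientation `μ`: `+1` if `e` transports `μ` to itself, `-1` if to `-μ` (Hatcher 2002, §3.3,
p. 234; §2.2 for the degree `±1` of a homeomorphism). [folklore] -/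
def χ (μ : HomologicalOrientation ℤ X n) (e : X ≃ₜ X) : ℤˣ :=
  if μ.comap e = μ then 1 else -1

omit [T2Space X] [ChartedSpace (𝔼 n) X] [ConnectedSpace X] in
/-- `χ = 1` iff the orientation is preserved. [folklore] -/
theorem χ_eq_one_iff {μ : HomologicalOrientation ℤ X n} {e : X ≃ₜ X} :
    χ μ e = 1 ↔ μ.comap e = μ := by
  unfold χ
  constructor
  · intro h
    by_contra h'
    rw [if_neg h'] at h
    exact absurd h (by decide)
  · intro h
    rw [if_pos h]

omit [T2Space X] [ChartedSpace (𝔼 n) X] [ConnectedSpace X] in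
/-- `χ = 1` iff `Pres`. [folklore] -/
theorem pres_iff_χ_eq_one {μ : HomologicalOrientation ℤ X n} {e : X ≃ₜ X} :
    Pres μ e ↔ χ μ e = 1 :=
  pres_iff_comap_eq.trans χ_eq_one_iff.symm

/-- `χ = -1` iff the orientation is reversed. [folklore] -/
theorem χ_eq_neg_one_iff [Nonempty X] {μ : HomologicalOrientation ℤ X n} {e : X ≃ₜ X} :
    χ μ e = -1 ↔ μ.comap e = -μ := by
  unfold χ
  split_ifs with h
  · constructor
    · intro h1
      exact absurd h1 (by decide)
    · intro h2
      exact absurd (h.symm.trans h2) (ne_neg_self μ)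
  · exact ⟨fun _ ↦ (comap_eq_or_eq_neg μ e).resolve_left h, fun _ ↦ rfl⟩

omit [T2Space X] [ChartedSpace (𝔼 n) X] [ConnectedSpace X] in
/-- The sign only depends on the underlying map. [folklore] -/
theorem χ_congr {μ : HomologicalOrientation ℤ X n} {e e' : X ≃ₜ X} (h : ∀ x, e x = e' x) :
    χ μ e = χ μ e' := by
  rw [Homeomorph.ext h]

omit [T2Space X] [ChartedSpace (𝔼 n) X] [ConnectedSpace X] in
/-- Transport along a composite of homeomorphisms. [folklore] -/
theorem comap_trans (μ : HomologicalOrientation ℤ X n) (e e' : X ≃ₜ X) :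
    μ.comap (e.trans e') = (μ.comap e').comap e := by
  ext1
  funext y
  simp only [HomologicalOrientation.comap_localClass, localHomology.mapIso]
  have h₁ : MapsTo (e'.symm : C(X, X)) ({e' (e y)}ᶜ : Set X) {e y}ᶜ :=
    mapsTo_symm_compl_singleton e'.toEquiv (e y)
  have h₂ : MapsTo (e.symm : C(X, X)) ({e y}ᶜ : Set X) {y}ᶜ :=
    mapsTo_symm_compl_singleton e.toEquiv y
  rw [← map_comp_apply (e'.symm : C(X, X)) (e.symm : C(X, X)) h₁ h₂ (h₂.comp h₁)]
  exact congrArg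
    (fun φ : localHomology ℤ ℤ X (e' (e y)) n ⟶ localHomology ℤ ℤ X y n ↦
      φ (μ.localClass (e' (e y))))
    (map_congr_fun (ContinuousMap.ext fun _ ↦ rfl) _ _ n)

/-- **Multiplicativity of the sign**: `χ(e ≫ e') = χ(e) χ(e')`. [folklore] -/
theorem χ_trans [Nonempty X] (μ : HomologicalOrientation ℤ X n) (e e' : X ≃ₜ X) :
    χ μ (e.trans e') = χ μ e * χ μ e' := by
  have key : μ.comap (e.trans e') = (μ.comap e').comap e := comap_trans μ e e'
  rcases comap_eq_or_eq_neg μ e' with h' | h' <;> rcases comap_eq_or_eq_neg μ e with h | h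
  · rw [h', h] at key
    rw [χ_eq_one_iff.2 key, χ_eq_one_iff.2 h, χ_eq_one_iff.2 h', mul_one]
  · rw [h', h] at key
    rw [χ_eq_neg_one_iff.2 key, χ_eq_neg_one_iff.2 h, χ_eq_one_iff.2 h']
    simp
  · rw [h', comap_neg, h] at key
    rw [χ_eq_neg_one_iff.2 key, χ_eq_one_iff.2 h, χ_eq_neg_one_iff.2 h']
    simp
  · rw [h', comap_neg, h, neg_neg] at key
    rw [χ_eq_one_iff.2 key, χ_eq_neg_one_iff.2 h, χ_eq_neg_one_iff.2 h']
    simp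

omit [T2Space X] [ChartedSpace (𝔼 n) X] [ConnectedSpace X] in
/-- The identity has sign `1`. [folklore] -/
theorem χ_refl (μ : HomologicalOrientation ℤ X n) : χ μ (Homeomorph.refl X) = 1 :=
  pres_iff_χ_eq_one.1 (pres_refl μ)

end Sign

/-! ### Linear self-maps of `ℝⁿ` -/

section Linear

variable (n) in
/-- The standard basis of `ℝⁿ = EuclideanSpace ℝ (Fin n)`. [folklore] -/
def stdBasis : Module.Basis (Fin n) ℝ (𝔼 n) :=
  PiLp.basisFun 2 ℝ (Fin n)

/-- The linear self-map of `ℝⁿ` with matrix `M` in the standard basis, as a continuous linear map.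
[folklore] -/
def linE (M : Matrix (Fin n) (Fin n) ℝ) : 𝔼 n →L[ℝ] 𝔼 n :=
  LinearMap.toContinuousLinearMap (Matrix.toLin (stdBasis n) (stdBasis n) M)

/-- Values of `linE`. [folklore] -/
theorem linE_apply (M : Matrix (Fin n) (Fin n) ℝ) (z : 𝔼 n) :
    linE M z = Matrix.toLin (stdBasis n) (stdBasis n) M z := rfl

/-- `linE` as a function of the matrix is the underlying map of a linear map. [folklore] -/
theorem linE_eq_comp : (linE : Matrix (Fin n) (Fin n) ℝ → 𝔼 n →L[ℝ] 𝔼 n) =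
    ⇑((LinearMap.toContinuousLinearMap :
        (𝔼 n →ₗ[ℝ] 𝔼 n) ≃ₗ[ℝ] 𝔼 n →L[ℝ] 𝔼 n).toLinearMap ∘ₗ
      (Matrix.toLin (stdBasis n) (stdBasis n)).toLinearMap) := rfl

/-- `M ↦ linE M` is continuous (a linear map between finite-dimensional spaces). [folklore] -/
theorem continuous_linE : Continuous (linE : Matrix (Fin n) (Fin n) ℝ → 𝔼 n →L[ℝ] 𝔼 n) := by
  rw [linE_eq_comp]
  exact LinearMap.continuous_of_finiteDimensional _

/-- `linE 1 = id`. [folklore] -/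
@[simp] theorem linE_one_apply (z : 𝔼 n) : linE (1 : Matrix (Fin n) (Fin n) ℝ) z = z := by
  rw [linE_apply, Matrix.toLin_one, LinearMap.id_apply]

/-- `linE (M N) = linE M ∘ linE N`. [folklore] -/
theorem linE_mul_apply (M N : Matrix (Fin n) (Fin n) ℝ) (z : 𝔼 n) :
    linE (M * N) z = linE M (linE N z) := by
  rw [linE_apply, Matrix.toLin_mul (stdBasis n) (stdBasis n) (stdBasis n), LinearMap.comp_apply]
  rfl

/-- `det (linE M) = det M`. [folklore] -/
theorem det_linE (M : Matrix (Fin n) (Fin n) ℝ) : (linE M).det = M.det :=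
  LinearMap.det_toLin (stdBasis n) M

/-- An invertible matrix acts injectively. [folklore] -/
theorem linE_injective {M : Matrix (Fin n) (Fin n) ℝ} (hM : M.det ≠ 0) : Injective (linE M) := by
  intro a b h
  have h' := congrArg (linE M⁻¹) h
  rwa [← linE_mul_apply, ← linE_mul_apply, Matrix.nonsing_inv_mul _ (isUnit_iff_ne_zero.2 hM),
    linE_one_apply, linE_one_apply] at h'

/-- `linE M` as a bundled continuous map. [folklore] -/
def linEC (M : Matrix (Fin n) (Fin n) ℝ) : C(𝔼 n, 𝔼 n) := ⟨linE M, (linE M).continuous⟩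

/-- Values of `linEC`. [folklore] -/
@[simp] theorem linEC_apply (M : Matrix (Fin n) (Fin n) ℝ) (z : 𝔼 n) : linEC M z = linE M z := rfl

/-- The homeomorphism of `ℝⁿ` underlying a continuous linear map of nonzero determinant.
[folklore] -/
def clmHomeo (A : 𝔼 n →L[ℝ] 𝔼 n) (hA : A.det ≠ 0) : 𝔼 n ≃ₜ 𝔼 n :=
  (A.toContinuousLinearEquivOfDetNeZero hA).toHomeomorph

/-- Values of `clmHomeo`. [folklore] -/
@[simp] theorem clmHomeo_apply (A : 𝔼 n →L[ℝ] 𝔼 n) (hA : A.det ≠ 0) (z : 𝔼 n) :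
    clmHomeo A hA z = A z := rfl

/-- The homeomorphism of `ℝⁿ` given by an invertible matrix. [folklore] -/
def linHomeo (M : Matrix (Fin n) (Fin n) ℝ) (hM : M.det ≠ 0) : 𝔼 n ≃ₜ 𝔼 n :=
  clmHomeo (linE M) (by rwa [det_linE])

/-- Values of `linHomeo`. [folklore] -/
@[simp] theorem linHomeo_apply (M : Matrix (Fin n) (Fin n) ℝ) (hM : M.det ≠ 0) (z : 𝔼 n) :
    linHomeo M hM z = linE M z := rfl

/-- `linHomeo M` sends `ℝⁿ ∖ 0` to itself. [folklore] -/
theorem mapsTo_linEC {M : Matrix (Fin n) (Fin n) ℝ} (hM : M.det ≠ 0) :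
    MapsTo (linEC M) ({0}ᶜ : Set (𝔼 n)) {0}ᶜ :=
  mapsTo_compl_singleton_of_injective (linE_injective hM) (map_zero _)

/-- The homotopy of linear maps along a path of matrices from `1` to `γ 1`. [folklore] -/
def linPathHomotopy (γ : ℝ → Matrix (Fin n) (Fin n) ℝ) (hγ : Continuous γ) (h0 : γ 0 = 1) :
    ContinuousMap.Homotopy (ContinuousMap.id (𝔼 n)) (linEC (γ 1)) where
  toFun p := linE (γ p.1) p.2
  continuous_toFun :=
    (continuous_linE.comp (hγ.comp (continuous_subtype_val.comp continuous_fst))).clm_apply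
      continuous_snd
  map_zero_left z := by simp [h0]
  map_one_left z := by simp

/-- **A matrix joined to `1` by a path of invertible matrices is the identity on `Hₙ(ℝⁿ | 0)`**
(Hatcher 2002, Prop. 2.19: the path is a homotopy of maps of pairs `(ℝⁿ, ℝⁿ ∖ 0) → (ℝⁿ, ℝⁿ ∖ 0)`).
[cite: HatcherAT2002, Prop. 2.19] -/
theorem map_linEC_eq_id (γ : ℝ → Matrix (Fin n) (Fin n) ℝ) (hγ : Continuous γ) (h0 : γ 0 = 1)
    (hdet : ∀ s : I, (γ s).det ≠ 0) (h : MapsTo (linEC (γ 1)) ({0}ᶜ : Set (𝔼 n)) {0}ᶜ) (k : ℕ) :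
    relativeSingularHomology.map ℤ ℤ (linEC (γ 1)) h k = 𝟙 (localHomology ℤ ℤ (𝔼 n) 0 k) := by
  have hF : ∀ p : I × 𝔼 n, p.2 ∈ ({0}ᶜ : Set (𝔼 n)) →
      linPathHomotopy γ hγ h0 p ∈ ({0}ᶜ : Set (𝔼 n)) := fun p hp ↦
    mem_compl_singleton_iff.2 fun h' ↦ mem_compl_singleton_iff.1 hp
      (linE_injective (hdet p.1) (h'.trans (map_zero (linE (γ p.1))).symm))
  rw [← relativeSingularHomology.map_eq_of_homotopic_holds ℤ ℤ (mapsTo_id _) h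
    (linPathHomotopy γ hγ h0) hF k, relativeSingularHomology.map_id]

/-- Along such a path the endpoint preserves the reference orientation `μ_E`: it fixes `μ_E` at the
origin by the previous lemma, hence everywhere (`ℝⁿ` is connected; Hatcher 2002, §3.3, p. 234–235,
orientations agreeing at one point agree). [folklore] -/
theorem pres_linHomeo_of_path (γ : ℝ → Matrix (Fin n) (Fin n) ℝ) (hγ : Continuous γ)
    (h0 : γ 0 = 1) (hdet : ∀ s : I, (γ s).det ≠ 0) :
    Pres (μE n) (linHomeo (γ 1) (hdet 1)) := by
  set e := linHomeo (γ 1) (hdet 1) with he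
  have key : ∀ (a b : 𝔼 n) (ha : a = 0) (hb : b = 0)
      (h : MapsTo (linEC (γ 1)) ({a}ᶜ : Set (𝔼 n)) {b}ᶜ),
      relativeSingularHomology.map ℤ ℤ (linEC (γ 1)) h n ((μE n).localClass a) =
        (μE n).localClass b := by
    rintro a b rfl rfl h
    rw [map_linEC_eq_id γ hγ h0 hdet h n]
    rfl
  rw [pres_iff_comap_eq]
  refine HomologicalOrientation.ext_of_connected_holds ℤ (𝔼 n) ((μE n).comap e) (μE n) 0 ?_
  rw [HomologicalOrientation.comap_localClass]
  have h1 : (localHomology.mapIso ℤ ℤ e 0 n).hom ((μE n).localClass 0) = (μE n).localClass (e 0) :=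
    key 0 (e 0) rfl (map_zero (linE (γ 1))) _
  rw [← h1]
  exact Iso.hom_inv_id_apply _ _

open Classical in
/-- The sign of (the homeomorphism of) a matrix on `μ_E`; `1` by convention for singular matrices.
[folklore] -/
def χM (M : Matrix (Fin n) (Fin n) ℝ) : ℤˣ :=
  if h : M.det ≠ 0 then χ (μE n) (linHomeo M h) else 1

/-- `χM` of an invertible matrix. [folklore] -/
theorem χM_of_det {M : Matrix (Fin n) (Fin n) ℝ} (hM : M.det ≠ 0) :
    χM M = χ (μE n) (linHomeo M hM) :=
  dif_pos hM

/-- `χM 1 = 1`. [folklore] -/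
theorem χM_one : χM (1 : Matrix (Fin n) (Fin n) ℝ) = 1 := by
  rw [χM_of_det (by simp), χ_congr (e' := Homeomorph.refl (𝔼 n)) (fun z ↦ by simp), χ_refl]

/-- **`χM` is multiplicative on invertible matrices.** [folklore] -/
theorem χM_mul {A B : Matrix (Fin n) (Fin n) ℝ} (hA : A.det ≠ 0) (hB : B.det ≠ 0) :
    χM (A * B) = χM A * χM B := by
  have hAB : (A * B).det ≠ 0 := by
    rw [Matrix.det_mul]
    exact mul_ne_zero hA hB
  rw [χM_of_det hAB, χM_of_det hA, χM_of_det hB,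
    χ_congr (e' := (linHomeo B hB).trans (linHomeo A hA)) (fun z ↦ by simp [linE_mul_apply]),
    χ_trans, mul_comm]

/-- A path of invertible matrices from `1` ends at a matrix of sign `1`. [folklore] -/
theorem χM_eq_one_of_path (γ : ℝ → Matrix (Fin n) (Fin n) ℝ) (hγ : Continuous γ)
    (h0 : γ 0 = 1) (hdet : ∀ s : I, (γ s).det ≠ 0) : χM (γ 1) = 1 := by
  rw [χM_of_det (show (γ 1).det ≠ 0 from hdet 1)]
  exact pres_iff_χ_eq_one.1 (pres_linHomeo_of_path γ hγ h0 hdet)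

/-- The endpoints of a path of invertible matrices have the same sign. [folklore] -/
theorem χM_eq_of_path (γ : ℝ → Matrix (Fin n) (Fin n) ℝ) (hγ : Continuous γ)
    (hdet : ∀ s : I, (γ s).det ≠ 0) : χM (γ 1) = χM (γ 0) := by
  have h0 : (γ 0).det ≠ 0 := hdet 0
  have h0u : IsUnit (γ 0).det := isUnit_iff_ne_zero.2 h0
  have hinv : (γ 0)⁻¹.det ≠ 0 := by
    rw [Matrix.det_nonsing_inv, Ring.inverse_eq_inv']
    exact inv_ne_zero h0
  set δ : ℝ → Matrix (Fin n) (Fin n) ℝ := fun s ↦ γ s * (γ 0)⁻¹ with hδ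
  have hδc : Continuous δ := hγ.matrix_mul continuous_const
  have hδ0 : δ 0 = 1 := Matrix.mul_nonsing_inv _ h0u
  have hδdet : ∀ s : I, (δ s).det ≠ 0 := fun s ↦ by
    rw [hδ, Matrix.det_mul]
    exact mul_ne_zero (hdet s) hinv
  have h1 : χM (γ 1 * (γ 0)⁻¹) = 1 := χM_eq_one_of_path δ hδc hδ0 hδdet
  rw [χM_mul (show (γ 1).det ≠ 0 from hdet 1) hinv] at h1
  have h2 : χM (γ 0) * χM (γ 0)⁻¹ = 1 := by
    rw [← χM_mul h0 hinv, Matrix.mul_nonsing_inv _ h0u, χM_one]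
  exact mul_right_cancel (h1.trans h2.symm)

/-- **Transvections have sign `1`** (they are joined to `1` by transvections). [folklore] -/
theorem χM_transvection {i j : Fin n} (hij : i ≠ j) (c : ℝ) :
    χM (Matrix.transvection i j c) = 1 := by
  set γ : ℝ → Matrix (Fin n) (Fin n) ℝ := fun s ↦ 1 + (s * c) • Matrix.single i j (1 : ℝ) with hγ
  have hγt : ∀ s, γ s = Matrix.transvection i j (s * c) := fun s ↦ by
    simp [hγ, Matrix.transvection, Matrix.smul_single]
  have hγc : Continuous γ := continuous_const.add ((continuous_id.mul continuous_const).smul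
    continuous_const)
  have h0 : γ 0 = 1 := by simp [hγ]
  have hdet : ∀ s : I, (γ s).det ≠ 0 := fun s ↦ by
    rw [hγt, Matrix.det_transvection_of_ne i j hij]
    exact one_ne_zero
  have h1 := χM_eq_one_of_path γ hγc h0 hdet
  rwa [hγt, one_mul] at h1

/-- `det (diagonal (update 1 i b)) = b`. [folklore] -/
theorem det_diagonal_update (i : Fin n) (b : ℝ) :
    (Matrix.diagonal (update (1 : Fin n → ℝ) i b)).det = b := by
  rw [Matrix.det_diagonal, Finset.prod_update_of_mem (Finset.mem_univ i)]
  simp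

/-- **A single positive diagonal entry has sign `1`** (join it to `1`). [folklore] -/
theorem χM_diagonal_update_pos (i : Fin n) {c : ℝ} (hc : 0 < c) :
    χM (Matrix.diagonal (update (1 : Fin n → ℝ) i c)) = 1 := by
  set γ : ℝ → Matrix (Fin n) (Fin n) ℝ :=
    fun s ↦ Matrix.diagonal (update (1 : Fin n → ℝ) i (1 - s + s * c)) with hγ
  have hγc : Continuous γ :=
    (continuous_const.update i ((continuous_const.sub continuous_id).add
      (continuous_id.mul continuous_const))).matrix_diagonal
  have h0 : γ 0 = 1 := by
    simp only [hγ, sub_zero, zero_mul, add_zero]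
    rw [show update (1 : Fin n → ℝ) i 1 = 1 from update_eq_self i (1 : Fin n → ℝ)]
    exact Matrix.diagonal_one
  have hdet : ∀ s : I, (γ s).det ≠ 0 := fun s ↦ by
    rw [hγ, det_diagonal_update]
    have h1 : 0 ≤ 1 - (s : ℝ) := unitInterval.one_minus_nonneg s
    have h2 : 0 ≤ (s : ℝ) * c := mul_nonneg s.2.1 hc.le
    rcases eq_or_lt_of_le s.2.1 with hs | hs
    · rw [← hs]
      norm_num
    · exact (add_pos_of_nonneg_of_pos h1 (mul_pos hs hc)).ne'
  have h1 := χM_eq_one_of_path γ hγc h0 hdet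
  simp only [hγ, sub_self, one_mul, zero_add] at h1
  exact h1

/-- Conjugating a single diagonal entry by a transposition moves it: the two diagonal matrices
`diag(1,…,c,…,1)` (entry at `i` or at `j`) have the same sign. [folklore] -/
theorem χM_diagonal_update_eq (i j : Fin n) {c : ℝ} (hc : c ≠ 0) :
    χM (Matrix.diagonal (update (1 : Fin n → ℝ) i c)) =
      χM (Matrix.diagonal (update (1 : Fin n → ℝ) j c)) := by
  set sw : Equiv.Perm (Fin n) := Equiv.swap i j with hsw
  set P : Matrix (Fin n) (Fin n) ℝ := Equiv.Perm.permMatrix ℝ sw with hP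
  have hPdet : P.det ≠ 0 := by
    rw [hP, Matrix.det_permutation]
    exact Int.cast_ne_zero.2 (Units.ne_zero _)
  have hconj : P * Matrix.diagonal (update (1 : Fin n → ℝ) j c) * P =
      Matrix.diagonal (update (1 : Fin n → ℝ) i c) := by
    rw [hP, Equiv.Perm.permMatrix, PEquiv.toMatrix_toPEquiv_mul, PEquiv.mul_toMatrix_toPEquiv,
      Matrix.submatrix_submatrix, hsw, Equiv.symm_swap]
    simp only [Function.comp_id, Function.id_comp]
    rw [Matrix.submatrix_diagonal_equiv, update_comp_equiv]
    simp
  have hDj : (Matrix.diagonal (update (1 : Fin n → ℝ) j c)).det ≠ 0 := by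
    rwa [det_diagonal_update]
  have hPD : (P * Matrix.diagonal (update (1 : Fin n → ℝ) j c)).det ≠ 0 := by
    rw [Matrix.det_mul]
    exact mul_ne_zero hPdet hDj
  rw [← hconj, χM_mul hPD hPdet, χM_mul hPdet hDj, mul_comm (χM P), mul_assoc,
    Int.units_mul_self, mul_one]

/-- Splitting off one diagonal entry. [folklore] -/
theorem diagonal_update_eq_mul (f : Fin n → ℝ) (a : Fin n) (b : ℝ) (hfa : f a = 1) :
    Matrix.diagonal (update f a b) =
      Matrix.diagonal (update (1 : Fin n → ℝ) a b) * Matrix.diagonal f := by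
  rw [Matrix.diagonal_mul_diagonal]
  congr 1
  funext k
  by_cases hk : k = a
  · subst hk
    simp [hfa]
  · simp [hk]

/-- Multiplying two single-entry diagonal matrices at the same place. [folklore] -/
theorem diagonal_update_mul (a : Fin n) (b b' : ℝ) :
    Matrix.diagonal (update (1 : Fin n → ℝ) a b) * Matrix.diagonal (update (1 : Fin n → ℝ) a b') =
      Matrix.diagonal (update (1 : Fin n → ℝ) a (b * b')) := by
  rw [Matrix.diagonal_mul_diagonal]
  congr 1
  funext k
  by_cases hk : k = a
  · subst hk
    simp
  · simp [hk]

/-- **An invertible diagonal matrix has the sign of `diag(det, 1, …, 1)`**: move every entry to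
the slot `i₀` by transpositions and multiply them there. [folklore] -/
theorem χM_diagonal (i₀ : Fin n) (d : Fin n → ℝ) (hd : ∀ i, d i ≠ 0) :
    χM (Matrix.diagonal d) = χM (Matrix.diagonal (update (1 : Fin n → ℝ) i₀ (∏ i, d i))) := by
  classical
  suffices H : ∀ s : Finset (Fin n), χM (Matrix.diagonal (s.piecewise d 1)) =
      χM (Matrix.diagonal (update (1 : Fin n → ℝ) i₀ (∏ i ∈ s, d i))) by
    simpa using H Finset.univ
  intro s
  induction s using Finset.induction_on with
  | empty =>
    simp only [Finset.piecewise_empty, Finset.prod_empty]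
    rw [show update (1 : Fin n → ℝ) i₀ 1 = 1 from update_eq_self i₀ (1 : Fin n → ℝ)]
  | @insert a s has ih =>
    have hfa : s.piecewise d 1 a = 1 := Finset.piecewise_eq_of_notMem _ _ _ has
    have hdet₁ : (Matrix.diagonal (update (1 : Fin n → ℝ) a (d a))).det ≠ 0 := by
      rw [det_diagonal_update]
      exact hd a
    have hdet₂ : (Matrix.diagonal (s.piecewise d 1)).det ≠ 0 := by
      rw [Matrix.det_diagonal]
      exact Finset.prod_ne_zero_iff.2 fun k _ ↦ by
        by_cases hk : k ∈ s
        · rw [Finset.piecewise_eq_of_mem _ _ _ hk]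
          exact hd k
        · rw [Finset.piecewise_eq_of_notMem _ _ _ hk]
          exact one_ne_zero
    have hdet₃ : (Matrix.diagonal (update (1 : Fin n → ℝ) i₀ (d a))).det ≠ 0 := by
      rw [det_diagonal_update]
      exact hd a
    have hdet₄ : (Matrix.diagonal (update (1 : Fin n → ℝ) i₀ (∏ i ∈ s, d i))).det ≠ 0 := by
      rw [det_diagonal_update]
      exact Finset.prod_ne_zero_iff.2 fun k _ ↦ hd k
    rw [Finset.piecewise_insert, diagonal_update_eq_mul _ _ _ hfa, χM_mul hdet₁ hdet₂, ih,
      χM_diagonal_update_eq a i₀ (hd a), ← χM_mul hdet₃ hdet₄, diagonal_update_mul,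
      Finset.prod_insert has]

/-- **Every invertible matrix has the sign of `diag(det M, 1, …, 1)`**, by Mathlib's
decomposition into transvections and a diagonal matrix
(`Matrix.diagonal_transvection_induction_of_det_ne_zero`). [folklore] -/
theorem χM_eq_χM_diagonal_det (i₀ : Fin n) (M : Matrix (Fin n) (Fin n) ℝ) (hM : M.det ≠ 0) :
    χM M = χM (Matrix.diagonal (update (1 : Fin n → ℝ) i₀ M.det)) := by
  refine Matrix.diagonal_transvection_induction_of_det_ne_zero
    (fun N ↦ χM N = χM (Matrix.diagonal (update (1 : Fin n → ℝ) i₀ N.det))) M hM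
    (fun D hD ↦ ?_) (fun t ↦ ?_) (fun A B hA hB ihA ihB ↦ ?_)
  · rw [Matrix.det_diagonal] at hD ⊢
    exact χM_diagonal i₀ D fun i ↦ (Finset.prod_ne_zero_iff.1 hD) i (Finset.mem_univ i)
  · rw [Matrix.TransvectionStruct.det,
      show update (1 : Fin n → ℝ) i₀ 1 = 1 from update_eq_self i₀ (1 : Fin n → ℝ),
      show Matrix.diagonal (1 : Fin n → ℝ) = 1 from Matrix.diagonal_one, χM_one]
    exact χM_transvection t.hij t.c
  · have hdA : (Matrix.diagonal (update (1 : Fin n → ℝ) i₀ A.det)).det ≠ 0 := by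
      rwa [det_diagonal_update]
    have hdB : (Matrix.diagonal (update (1 : Fin n → ℝ) i₀ B.det)).det ≠ 0 := by
      rwa [det_diagonal_update]
    rw [χM_mul hA hB, ihA, ihB, ← χM_mul hdA hdB, diagonal_update_mul, Matrix.det_mul]

/-- **A matrix of positive determinant has sign `1`**, i.e. preserves `μ_E`; no use is made of the
(harder) fact that reflections have sign `-1`. [folklore] -/
theorem χM_eq_one_of_det_pos (M : Matrix (Fin n) (Fin n) ℝ) (hM : 0 < M.det) : χM M = 1 := by
  cases isEmpty_or_nonempty (Fin n) with
  | inl h =>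
    rw [Subsingleton.elim M 1, χM_one]
  | inr h =>
    obtain ⟨i₀⟩ := h
    rw [χM_eq_χM_diagonal_det i₀ M hM.ne', χM_diagonal_update_pos i₀ hM]

/-- **Linear maps of positive determinant preserve `μ_E`.** [folklore] -/
theorem pres_clmHomeo_of_det_pos (A : 𝔼 n →L[ℝ] 𝔼 n) (hA : 0 < A.det) :
    Pres (μE n) (clmHomeo A hA.ne') := by
  set M : Matrix (Fin n) (Fin n) ℝ := LinearMap.toMatrix (stdBasis n) (stdBasis n) A with hM
  have hMA : ∀ z, linE M z = A z := fun z ↦ by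
    rw [linE_apply, hM, Matrix.toLin_toMatrix]
    rfl
  have hMdet : M.det = A.det := by
    rw [hM, LinearMap.det_toMatrix]
  have hM0 : M.det ≠ 0 := by
    rw [hMdet]
    exact hA.ne'
  have h1 : χM M = 1 := χM_eq_one_of_det_pos M (by rwa [hMdet])
  rw [χM_of_det hM0] at h1
  exact (pres_congr (fun z ↦ by simp [hMA])).1 (pres_iff_χ_eq_one.2 h1)

/-- **Affine maps with linear part of positive determinant preserve `μ_E`** (translations and
positive linear maps do). [folklore] -/
theorem pres_of_affine (e : 𝔼 n ≃ₜ 𝔼 n) (A : 𝔼 n →L[ℝ] 𝔼 n) (hA : 0 < A.det) (w : 𝔼 n)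
    (he : ∀ z, e z = A z + w) : Pres (μE n) e :=
  (pres_congr (e := (clmHomeo A hA.ne').trans (Homeomorph.addRight w)) (e' := e)
    (fun z ↦ by simp [he])).1 ((pres_clmHomeo_of_det_pos A hA).trans (pres_addRight w))

end Linear

/-! ### Linearization: a local homeomorphism acts on local homology as its derivative -/

section Linearization

variable {W : Set (𝔼 n)} {G : 𝔼 n → 𝔼 n} {p : 𝔼 n} {A : 𝔼 n →L[ℝ] 𝔼 n} {δ : ℝ}

/-- The difference-quotient deformation `Φ(s, v) = s⁻¹ (G(p + s v) - G(p))` for `s ≠ 0`,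
`Φ(0, v) = DG(p) v` (Milnor, *Topology from the Differentiable Viewpoint*, §6, proof of Lemma 3:
"`f` is smoothly isotopic to its derivative"; Bredon 1993, VI.7). [folklore] -/
def linDeform (G : 𝔼 n → 𝔼 n) (p : 𝔼 n) (A : 𝔼 n →L[ℝ] 𝔼 n) (s : ℝ) (v : 𝔼 n) : 𝔼 n :=
  if s = 0 then A v else s⁻¹ • (G (p + s • v) - G p)

/-- Value at `s = 0`. [folklore] -/
theorem linDeform_zero (v : 𝔼 n) : linDeform G p A 0 v = A v := if_pos rfl

/-- Value at `s ≠ 0`. [folklore] -/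
theorem linDeform_of_ne {s : ℝ} (hs : s ≠ 0) (v : 𝔼 n) :
    linDeform G p A s v = s⁻¹ • (G (p + s • v) - G p) := if_neg hs

/-- For `s ∈ [0, 1]` and `‖v‖ < δ`, `p + s v ∈ B(p, δ)`. [folklore] -/
theorem add_smul_mem_ball {s : ℝ} (hs : s ∈ Icc (0 : ℝ) 1) {v : 𝔼 n} (hv : v ∈ ball (0 : 𝔼 n) δ) :
    p + s • v ∈ ball p δ := by
  rw [mem_ball_iff_norm, add_sub_cancel_left, norm_smul, Real.norm_of_nonneg hs.1]
  rw [mem_ball_zero_iff] at hv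
  calc s * ‖v‖ ≤ 1 * ‖v‖ := by gcongr; exact hs.2
    _ < δ := by rwa [one_mul]

/-- **Continuity of the difference-quotient deformation** on `[0, 1] × B(0, δ)` when
`B(p, δ) ⊆ W`, `G` is continuous on `W` and differentiable at `p` with derivative `A`: at `s = 0`
this is exactly the definition of the derivative. [folklore] -/
theorem continuousOn_linDeform (hGc : ContinuousOn G W) (hGd : HasFDerivAt G A p) (hδ : 0 < δ)
    (hB : ball p δ ⊆ W) :
    ContinuousOn (fun q : ℝ × 𝔼 n ↦ linDeform G p A q.1 q.2)
      (Icc (0 : ℝ) 1 ×ˢ ball (0 : 𝔼 n) δ) := by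
  rintro ⟨s₀, v₀⟩ ⟨hs₀, hv₀⟩
  by_cases hs : s₀ = 0
  · subst hs
    rw [Metric.continuousWithinAt_iff]
    intro ε hε
    have hc : 0 < ε / (2 * δ) := by positivity
    obtain ⟨r, hr, hrG⟩ := Metric.eventually_nhds_iff.1
      ((hasFDerivAt_iff_isLittleO_nhds_zero.1 hGd).def hc)
    have hA1 : 0 < ‖A‖ + 1 := by positivity
    refine ⟨min (r / δ) (ε / (2 * (‖A‖ + 1))), by positivity, ?_⟩
    rintro ⟨s, v⟩ ⟨hs, hv⟩ hdist
    rw [Prod.dist_eq, max_lt_iff] at hdist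
    obtain ⟨hds, hdv⟩ := hdist
    dsimp only at hds hdv hs hv ⊢
    rw [linDeform_zero]
    have hvv : ‖v - v₀‖ < ε / (2 * (‖A‖ + 1)) := by
      rw [← dist_eq_norm]
      exact lt_of_lt_of_le hdv (min_le_right _ _)
    have hAv : ‖A (v - v₀)‖ < ε / 2 := by
      calc ‖A (v - v₀)‖ ≤ ‖A‖ * ‖v - v₀‖ := A.le_opNorm _
        _ ≤ (‖A‖ + 1) * ‖v - v₀‖ := by gcongr; linarith
        _ < (‖A‖ + 1) * (ε / (2 * (‖A‖ + 1))) := by gcongr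
        _ = ε / 2 := by field_simp
    by_cases hs0 : s = 0
    · subst hs0
      rw [linDeform_zero, dist_eq_norm, ← map_sub]
      linarith
    · have hs_pos : 0 < s := lt_of_le_of_ne hs.1 (Ne.symm hs0)
      rw [linDeform_of_ne hs0, dist_eq_norm]
      have hvδ : ‖v‖ < δ := mem_ball_zero_iff.1 hv
      have hsr : s < r / δ := by
        have := lt_of_lt_of_le hds (min_le_left _ _)
        rwa [Real.dist_eq, sub_zero, abs_of_pos hs_pos] at this
      have hsv : ‖s • v‖ < r := by
        rw [norm_smul, Real.norm_of_nonneg hs.1]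
        calc s * ‖v‖ ≤ s * δ := by gcongr
          _ < r / δ * δ := by gcongr
          _ = r := div_mul_cancel₀ r hδ.ne'
      have key : ‖G (p + s • v) - G p - A (s • v)‖ ≤ ε / (2 * δ) * ‖s • v‖ :=
        hrG (by rwa [dist_zero_right])
      have eq : s⁻¹ • (G (p + s • v) - G p) - A v₀ =
          s⁻¹ • (G (p + s • v) - G p - A (s • v)) + A (v - v₀) := by
        rw [map_smul, smul_sub _ _ (s • A v), smul_smul, inv_mul_cancel₀ hs0, one_smul, map_sub]
        abel
      rw [eq]
      have h1 : ‖s⁻¹ • (G (p + s • v) - G p - A (s • v))‖ ≤ ε / 2 := by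
        rw [norm_smul, Real.norm_of_nonneg (inv_nonneg.2 hs.1)]
        calc s⁻¹ * ‖G (p + s • v) - G p - A (s • v)‖ ≤ s⁻¹ * (ε / (2 * δ) * ‖s • v‖) := by
              gcongr
          _ = ε / (2 * δ) * ‖v‖ := by
              rw [norm_smul, Real.norm_of_nonneg hs.1]
              field_simp
          _ ≤ ε / (2 * δ) * δ := by gcongr
          _ = ε / 2 := by field_simp
      calc ‖s⁻¹ • (G (p + s • v) - G p - A (s • v)) + A (v - v₀)‖
          ≤ ‖s⁻¹ • (G (p + s • v) - G p - A (s • v))‖ + ‖A (v - v₀)‖ := norm_add_le _ _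
        _ < ε / 2 + ε / 2 := add_lt_add_of_le_of_lt h1 hAv
        _ = ε := by ring
  · have hmaps : MapsTo (fun q : ℝ × 𝔼 n ↦ p + q.1 • q.2) (Icc (0 : ℝ) 1 ×ˢ ball (0 : 𝔼 n) δ) W :=
      fun q hq ↦ hB (add_smul_mem_ball hq.1 hq.2)
    have hg : ContinuousWithinAt (fun q : ℝ × 𝔼 n ↦ q.1⁻¹ • (G (p + q.1 • q.2) - G p))
        (Icc (0 : ℝ) 1 ×ˢ ball (0 : 𝔼 n) δ) (s₀, v₀) := by
      refine ((continuous_fst.continuousWithinAt).inv₀ hs).smul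
        (ContinuousWithinAt.sub ?_ continuousWithinAt_const)
      have hGw : ContinuousWithinAt G W (p + s₀ • v₀) := hGc _ (hB (add_smul_mem_ball hs₀ hv₀))
      exact hGw.comp (f := fun q : ℝ × 𝔼 n ↦ p + q.1 • q.2)
        (by fun_prop : Continuous fun q : ℝ × 𝔼 n ↦ p + q.1 • q.2).continuousWithinAt hmaps
    refine hg.congr_of_eventuallyEq ?_ (linDeform_of_ne hs v₀)
    have hev : ∀ᶠ q : ℝ × 𝔼 n in 𝓝[Icc (0 : ℝ) 1 ×ˢ ball (0 : 𝔼 n) δ] (s₀, v₀), q.1 ≠ 0 :=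
      eventually_nhdsWithin_of_eventually_nhds
        ((isOpen_compl_singleton.preimage continuous_fst).mem_nhds hs)
    exact hev.mono fun q hq ↦ linDeform_of_ne hq _

/-- `G` restricted to the ball `B(p, δ) ⊆ W`, as a continuous map. [folklore] -/
def ballMap (hGc : ContinuousOn G W) (hB : ball p δ ⊆ W) : C(↥(ball p δ), 𝔼 n) :=
  ⟨fun z ↦ G z, hGc.comp_continuous continuous_subtype_val fun z ↦ hB z.2⟩

/-- Values of `ballMap`. [folklore] -/
@[simp] theorem ballMap_apply (hGc : ContinuousOn G W) (hB : ball p δ ⊆ W) (z : ↥(ball p δ)) :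
    ballMap hGc hB z = G z := rfl

/-- The affine approximation `z ↦ q + A (z - p)` of `G` at `p`, on all of `ℝⁿ`. [folklore] -/
def affineApprox (q p : 𝔼 n) (A : 𝔼 n →L[ℝ] 𝔼 n) : C(𝔼 n, 𝔼 n) :=
  ⟨fun z ↦ q + A (z - p), by fun_prop⟩

/-- Values of `affineApprox`. [folklore] -/
@[simp] theorem affineApprox_apply (q p : 𝔼 n) (A : 𝔼 n →L[ℝ] 𝔼 n) (z : 𝔼 n) :
    affineApprox q p A z = q + A (z - p) := rfl

/-- The affine approximation restricted to the ball `B(p, δ)`. [folklore] -/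
def ballAffine (q p : 𝔼 n) (A : 𝔼 n →L[ℝ] 𝔼 n) (δ : ℝ) : C(↥(ball p δ), 𝔼 n) :=
  ⟨fun z ↦ q + A ((z : 𝔼 n) - p), by fun_prop⟩

/-- **The linearization homotopy** on the ball `B(p, δ) ⊆ W`, from the affine approximation
`z ↦ G p + A (z - p)` (`s = 0`) to `G` (`s = 1`): `(s, z) ↦ G p + Φ(s, z - p)`. [folklore] -/
def linHomotopy (hGc : ContinuousOn G W) (hGd : HasFDerivAt G A p) (hδ : 0 < δ)
    (hB : ball p δ ⊆ W) :
    ContinuousMap.Homotopy (ballAffine (G p) p A δ) (ballMap hGc hB) where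
  toFun q := G p + linDeform G p A q.1 ((q.2 : 𝔼 n) - p)
  continuous_toFun := by
    refine continuous_const.add ?_
    have hmap : ∀ q : I × ↥(ball p δ),
        ((q.1 : ℝ), (q.2 : 𝔼 n) - p) ∈ Icc (0 : ℝ) 1 ×ˢ ball (0 : 𝔼 n) δ := fun q ↦
      ⟨q.1.2, by rw [mem_ball_zero_iff, ← mem_ball_iff_norm]; exact q.2.2⟩
    exact (continuousOn_linDeform hGc hGd hδ hB).comp_continuous
      ((continuous_subtype_val.comp continuous_fst).prodMk
        ((continuous_subtype_val.comp continuous_snd).sub continuous_const)) hmap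
  map_zero_left z := by
    show G p + linDeform G p A ((0 : I) : ℝ) ((z : 𝔼 n) - p) = G p + A ((z : 𝔼 n) - p)
    rw [Set.Icc.coe_zero, linDeform_zero]
  map_one_left z := by
    show G p + linDeform G p A ((1 : I) : ℝ) ((z : 𝔼 n) - p) = G z
    rw [Set.Icc.coe_one, linDeform_of_ne one_ne_zero]
    simp

/-- Along the linearization homotopy no point other than the centre is mapped to `G p`
(`G` injective on `W`, `A` injective). [folklore] -/
theorem linHomotopy_ne (hGc : ContinuousOn G W) (hGi : InjOn G W) (hGd : HasFDerivAt G A p)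
    (hA : Injective A) (hδ : 0 < δ) (hB : ball p δ ⊆ W) (q : I × ↥(ball p δ))
    (hq : (q.2 : 𝔼 n) ≠ p) : linHomotopy hGc hGd hδ hB q ≠ G p := by
  intro h
  have h' : linDeform G p A q.1 ((q.2 : 𝔼 n) - p) = 0 := by
    have h'' : G p + linDeform G p A q.1 ((q.2 : 𝔼 n) - p) = G p := h
    exact add_eq_left.1 h''
  by_cases hs : (q.1 : ℝ) = 0
  · rw [hs, linDeform_zero] at h'
    exact hq (sub_eq_zero.1 (hA (h'.trans (map_zero A).symm)))
  · rw [linDeform_of_ne hs] at h'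
    have hmem : p + (q.1 : ℝ) • ((q.2 : 𝔼 n) - p) ∈ ball p δ :=
      add_smul_mem_ball q.1.2 (by rw [mem_ball_zero_iff, ← mem_ball_iff_norm]; exact q.2.2)
    rcases smul_eq_zero.1 h' with h'' | h''
    · exact hs (inv_eq_zero.1 h'')
    · have h3 := hGi (hB hmem) (hB (mem_ball_self hδ)) (sub_eq_zero.1 h'')
      rcases smul_eq_zero.1 (add_eq_left.1 h3) with h4 | h4
      · exact hs h4
      · exact hq (sub_eq_zero.1 h4)

/-- **Linearization in local homology** (Bredon 1993, VI.7; Milnor–Stasheff 1974, App. A: the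
local degree of a `C¹` local homeomorphism at `p` is that of its derivative): on local homology of
the ball at its centre, `G` and its affine approximation `z ↦ G p + DG(p)(z - p)` induce the same
map `Hₖ(B | p) → Hₖ(ℝⁿ | G p)`, being homotopic through maps of pairs
`(B, B ∖ p) → (ℝⁿ, ℝⁿ ∖ G p)` (Hatcher 2002, Prop. 2.19). [cite: HatcherAT2002, Prop. 2.19] -/
theorem map_ballMap_eq (hGc : ContinuousOn G W) (hGi : InjOn G W) (hGd : HasFDerivAt G A p)
    (hA : Injective A) (hδ : 0 < δ) (hB : ball p δ ⊆ W) (x₀ : ↥(ball p δ)) (hx₀ : (x₀ : 𝔼 n) = p)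
    {q : 𝔼 n} (hq : G p = q)
    (h₁ : MapsTo (ballMap hGc hB) ({x₀}ᶜ : Set ↥(ball p δ)) {q}ᶜ)
    (h₀ : MapsTo (ballAffine q p A δ) ({x₀}ᶜ : Set ↥(ball p δ)) {q}ᶜ) (k : ℕ) :
    relativeSingularHomology.map ℤ ℤ (ballMap hGc hB) h₁ k =
      relativeSingularHomology.map ℤ ℤ (ballAffine q p A δ) h₀ k := by
  subst hq
  have hF : ∀ x : I × ↥(ball p δ), x.2 ∈ ({x₀}ᶜ : Set ↥(ball p δ)) →
      linHomotopy hGc hGd hδ hB x ∈ ({G p}ᶜ : Set (𝔼 n)) := fun x hx ↦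
    linHomotopy_ne hGc hGi hGd hA hδ hB x fun h ↦ hx (Subtype.ext (h.trans hx₀.symm))
  exact (relativeSingularHomology.map_eq_of_homotopic_holds ℤ ℤ h₀ h₁
    (linHomotopy hGc hGd hδ hB) hF k).symm

end Linearization

/-! ### Linearization between open subsets of `ℝⁿ`, through the excision isomorphisms -/

section LocalTransport

/-- **A local homeomorphism of `ℝⁿ` acts on `Hₖ(ℝⁿ | p) → Hₖ(ℝⁿ | G p)` as its affine
approximation.** For open `W, W' ⊆ ℝⁿ`, an injective continuous `g₀ : W → W'` with underlying map
`G` differentiable at `p ∈ W` with injective derivative `A`, the composite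
`Hₖ(ℝⁿ | p) ≅ Hₖ(W | p) → Hₖ(W' | G p) ≅ Hₖ(ℝⁿ | G p)` (excision isomorphisms, Hatcher 2002,
Thm. 2.20) is the map induced by `z ↦ G p + A (z - p)` (Bredon 1993, VI.7; Milnor–Stasheff 1974,
Appendix A). [folklore] -/
theorem openSubsetIso_map_eq_map_affine {W W' : Set (𝔼 n)} (hW : IsOpen W) (hW' : IsOpen W')
    (g₀ : C(↥W, ↥W')) (hg₀ : Injective g₀) {G : 𝔼 n → 𝔼 n} (hG : ∀ w : ↥W, (g₀ w : 𝔼 n) = G w)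
    (x : ↥W) (y : ↥W') {A : 𝔼 n →L[ℝ] 𝔼 n} (hGd : HasFDerivAt G A x) (hA : Injective A)
    (hb : G x = y) (h : MapsTo g₀ ({x}ᶜ : Set ↥W) {y}ᶜ)
    (h' : MapsTo (affineApprox (y : 𝔼 n) (x : 𝔼 n) A) ({(x : 𝔼 n)}ᶜ : Set (𝔼 n)) {(y : 𝔼 n)}ᶜ)
    (k : ℕ) (z : localHomology ℤ ℤ (↥W) x k) :
    (localHomology.openSubsetIso ℤ ℤ hW' y.2 k).hom (relativeSingularHomology.map ℤ ℤ g₀ h k z) =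
      relativeSingularHomology.map ℤ ℤ (affineApprox (y : 𝔼 n) (x : 𝔼 n) A) h' k
        ((localHomology.openSubsetIso ℤ ℤ hW x.2 k).hom z) := by
  have hGc : ContinuousOn G W := by
    rw [continuousOn_iff_continuous_restrict]
    have e : W.restrict G = fun w ↦ (g₀ w : 𝔼 n) := funext fun w ↦ (hG w).symm
    rw [e]
    fun_prop
  have hGi : InjOn G W := by
    intro a ha a' ha' heq
    have h1 : (g₀ ⟨a, ha⟩ : 𝔼 n) = g₀ ⟨a', ha'⟩ := by rw [hG, hG]; exact heq
    exact congrArg Subtype.val (hg₀ (Subtype.ext h1))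
  obtain ⟨δ, hδ, hB⟩ := Metric.isOpen_iff.1 hW x x.2
  let pB : ↥(ball (x : 𝔼 n) δ) := ⟨x, mem_ball_self hδ⟩
  let ι : C(↥(ball (x : 𝔼 n) δ), ↥W) := ⟨Set.inclusion hB, continuous_inclusion hB⟩
  have hι : MapsTo ι ({pB}ᶜ : Set ↥(ball (x : 𝔼 n) δ)) ({x}ᶜ : Set ↥W) :=
    mapsTo_compl_singleton_of_injective (inclusion_injective hB) (Subtype.ext rfl)
  have hval : MapsTo (subsetIncl W) ({x}ᶜ : Set ↥W) ({(x : 𝔼 n)}ᶜ : Set (𝔼 n)) :=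
    fun w hw hwx ↦ hw (Subtype.ext hwx)
  have hval' : MapsTo (subsetIncl W') ({y}ᶜ : Set ↥W') ({(y : 𝔼 n)}ᶜ : Set (𝔼 n)) :=
    fun w hw hwy ↦ hw (Subtype.ext hwy)
  have hvalB : MapsTo (subsetIncl (ball (x : 𝔼 n) δ)) ({pB}ᶜ : Set ↥(ball (x : 𝔼 n) δ))
      ({(x : 𝔼 n)}ᶜ : Set (𝔼 n)) :=
    fun w hw hwx ↦ hw (Subtype.ext hwx)
  have h₁ : MapsTo (ballMap hGc hB) ({pB}ᶜ : Set ↥(ball (x : 𝔼 n) δ))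
      ({(y : 𝔼 n)}ᶜ : Set (𝔼 n)) := by
    intro w hw hwb
    have hwb' : (g₀ (ι w) : 𝔼 n) ∈ ({(y : 𝔼 n)} : Set (𝔼 n)) := by rw [hG]; exact hwb
    exact hval' (h (hι hw)) hwb'
  have h₀ : MapsTo (ballAffine (y : 𝔼 n) (x : 𝔼 n) A δ) ({pB}ᶜ : Set ↥(ball (x : 𝔼 n) δ))
      ({(y : 𝔼 n)}ᶜ : Set (𝔼 n)) :=
    fun w hw ↦ h' (hval (hι hw))
  have eq₁ : relativeSingularHomology.map ℤ ℤ (ballMap hGc hB) h₁ k =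
      relativeSingularHomology.map ℤ ℤ ι hι k ≫ relativeSingularHomology.map ℤ ℤ g₀ h k ≫
        relativeSingularHomology.map ℤ ℤ (subsetIncl W') hval' k := by
    rw [← relativeSingularHomology.map_comp, ← relativeSingularHomology.map_comp]
    exact map_congr_fun (f := ballMap hGc hB) (f' := ((subsetIncl W').comp g₀).comp ι)
      (ContinuousMap.ext fun w ↦ (hG ⟨w, hB w.2⟩).symm) _ _ k
  have eq₀ : relativeSingularHomology.map ℤ ℤ (ballAffine (y : 𝔼 n) (x : 𝔼 n) A δ) h₀ k =
      relativeSingularHomology.map ℤ ℤ ι hι k ≫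
        relativeSingularHomology.map ℤ ℤ (subsetIncl W) hval k ≫
          relativeSingularHomology.map ℤ ℤ (affineApprox (y : 𝔼 n) (x : 𝔼 n) A) h' k := by
    rw [← relativeSingularHomology.map_comp, ← relativeSingularHomology.map_comp]
    exact map_congr_fun (f := ballAffine (y : 𝔼 n) (x : 𝔼 n) A δ)
      (f' := ((affineApprox (y : 𝔼 n) (x : 𝔼 n) A).comp (subsetIncl W)).comp ι)
      (ContinuousMap.ext fun w ↦ rfl) _ _ k
  have hE := map_ballMap_eq hGc hGi hGd hA hδ hB pB rfl hb h₁ h₀ k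
  have hιW : relativeSingularHomology.map ℤ ℤ ι hι k ≫
      (localHomology.openSubsetIso ℤ ℤ hW x.2 k).hom =
        (localHomology.openSubsetIso ℤ ℤ isOpen_ball (mem_ball_self hδ) k).hom := by
    rw [localHomology.openSubsetIso, localHomology.openSubsetIso, asIso_hom, asIso_hom,
      ← relativeSingularHomology.map_comp]
    exact map_congr_fun (f := (subsetIncl W).comp ι) (f' := subsetIncl (ball (x : 𝔼 n) δ))
      (ContinuousMap.ext fun w ↦ rfl) _ hvalB k
  haveI : IsIso (relativeSingularHomology.map ℤ ℤ ι hι k) := by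
    have e : relativeSingularHomology.map ℤ ℤ ι hι k =
        (localHomology.openSubsetIso ℤ ℤ isOpen_ball (mem_ball_self hδ) k).hom ≫
          (localHomology.openSubsetIso ℤ ℤ hW x.2 k).inv := by
      rw [← hιW, Category.assoc, Iso.hom_inv_id, Category.comp_id]
    rw [e]
    infer_instance
  have main : relativeSingularHomology.map ℤ ℤ g₀ h k ≫
      relativeSingularHomology.map ℤ ℤ (subsetIncl W') hval' k =
        relativeSingularHomology.map ℤ ℤ (subsetIncl W) hval k ≫
          relativeSingularHomology.map ℤ ℤ (affineApprox (y : 𝔼 n) (x : 𝔼 n) A) h' k := by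
    rw [← cancel_epi (relativeSingularHomology.map ℤ ℤ ι hι k), ← eq₁, ← eq₀]
    exact hE
  have hz := congrArg (fun φ : localHomology ℤ ℤ (↥W) x k ⟶
      localHomology ℤ ℤ (𝔼 n) (y : 𝔼 n) k ↦ φ z) main
  simp only [ModuleCat.comp_apply] at hz
  exact hz

/-- The affine homeomorphism `z ↦ q + A (z - p)` of `ℝⁿ` for invertible `A`. [folklore] -/
def affHomeo (q p : 𝔼 n) (A : 𝔼 n ≃L[ℝ] 𝔼 n) : 𝔼 n ≃ₜ 𝔼 n where
  toFun z := q + A (z - p)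
  invFun z := p + A.symm (z - q)
  left_inv z := by simp
  right_inv z := by simp
  continuous_toFun := by fun_prop
  continuous_invFun := by fun_prop

/-- **Sign-twisted linearization.** Let `R, R'` be homeomorphisms of `ℝⁿ` whose inverse, resp.
itself, is linear (`Rl`, `Rl'`), and `z ↦ q + A (z - p)` an affine map with
`det (Rl' ∘ A ∘ Rl) > 0`. Then the affine map carries the local class at `p` of the transported
orientation `μ_E.comap R` to the local class at `q` of `μ_E.comap R'`: conjugate by `R, R'` and
apply `pres_of_affine`. [folklore] -/
theorem map_affineApprox_comap (R R' : 𝔼 n ≃ₜ 𝔼 n) (Rl Rl' : 𝔼 n →L[ℝ] 𝔼 n)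
    (hR : ∀ z, R.symm z = Rl z) (hR' : ∀ z, R' z = Rl' z) (A : 𝔼 n →L[ℝ] 𝔼 n) (p q : 𝔼 n)
    (hdet : 0 < (Rl'.comp (A.comp Rl)).det)
    (h : MapsTo (affineApprox q p A) ({p}ᶜ : Set (𝔼 n)) {q}ᶜ) :
    relativeSingularHomology.map ℤ ℤ (affineApprox q p A) h n (((μE n).comap R).localClass p) =
      ((μE n).comap R').localClass q := by
  have hA : A.det ≠ 0 := by
    intro hA
    have : (Rl'.comp (A.comp Rl)).det = 0 := by
      show LinearMap.det ((Rl' : 𝔼 n →ₗ[ℝ] 𝔼 n) ∘ₗ ((A : 𝔼 n →ₗ[ℝ] 𝔼 n) ∘ₗ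
        (Rl : 𝔼 n →ₗ[ℝ] 𝔼 n))) = 0
      rw [LinearMap.det_comp, LinearMap.det_comp]
      rw [ContinuousLinearMap.det] at hA
      rw [hA, zero_mul, mul_zero]
    exact hdet.ne' this
  set Ae : 𝔼 n ≃L[ℝ] 𝔼 n := A.toContinuousLinearEquivOfDetNeZero hA with hAe
  set aff : 𝔼 n ≃ₜ 𝔼 n := affHomeo q p Ae with haff
  set Φ : 𝔼 n ≃ₜ 𝔼 n := R.symm.trans (aff.trans R') with hΦ
  have hΦ_apply : ∀ z, Φ z = (Rl'.comp (A.comp Rl)) z + Rl' (q - A p) := fun z ↦ by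
    show R' (q + Ae (R.symm z - p)) = Rl' (A (Rl z)) + Rl' (q - A p)
    rw [hR', hR, ← map_add]
    congr 1
    show q + A (Rl z - p) = A (Rl z) + (q - A p)
    rw [map_sub]
    abel
  have hPres : Pres (μE n) Φ := pres_of_affine Φ _ hdet _ hΦ_apply
  have hRs : MapsTo (R.symm : C(𝔼 n, 𝔼 n)) ({R p}ᶜ : Set (𝔼 n)) {p}ᶜ :=
    mapsTo_symm_compl_singleton R.toEquiv p
  have hR'm : MapsTo (R' : C(𝔼 n, 𝔼 n)) ({q}ᶜ : Set (𝔼 n)) {R' q}ᶜ :=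
    mapsTo_compl_singleton R'.toEquiv q
  have hΦm : MapsTo (Φ : C(𝔼 n, 𝔼 n)) ({R p}ᶜ : Set (𝔼 n)) {R' q}ᶜ := by
    refine mapsTo_compl_singleton_of_injective Φ.injective ?_
    show R' (q + Ae (R.symm (R p) - p)) = R' q
    rw [R.symm_apply_apply, sub_self, map_zero, add_zero]
  have key := hPres hΦm
  have h2 : MapsTo ((affineApprox q p A).comp (R.symm : C(𝔼 n, 𝔼 n))) ({R p}ᶜ : Set (𝔼 n))
      {q}ᶜ := fun z hz ↦ h (hRs hz)
  have h3 : MapsTo ((R' : C(𝔼 n, 𝔼 n)).comp ((affineApprox q p A).comp (R.symm : C(𝔼 n, 𝔼 n))))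
      ({R p}ᶜ : Set (𝔼 n)) {R' q}ᶜ := fun z hz ↦ hR'm (h2 hz)
  rw [map_congr_fun (f := (Φ : C(𝔼 n, 𝔼 n))) (f' := (R' : C(𝔼 n, 𝔼 n)).comp
      ((affineApprox q p A).comp (R.symm : C(𝔼 n, 𝔼 n)))) (ContinuousMap.ext fun _ ↦ rfl) hΦm
      h3 n,
    map_comp_apply _ _ h2 hR'm, map_comp_apply _ _ hRs h] at key
  have e1 : (localHomology.mapIso ℤ ℤ R' q n).hom =
      relativeSingularHomology.map ℤ ℤ (R' : C(𝔼 n, 𝔼 n)) hR'm n := rfl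
  have e2 : (localHomology.mapIso ℤ ℤ R p n).inv =
      relativeSingularHomology.map ℤ ℤ (R.symm : C(𝔼 n, 𝔼 n)) hRs n := rfl
  rw [HomologicalOrientation.comap_localClass, HomologicalOrientation.comap_localClass, ← key,
    ← e1, Iso.hom_inv_id_apply, e2]

end LocalTransport

/-! ### Transport of local homology along charts -/

section ChartTransport

variable {X : Type u} [TopologicalSpace X]

/-- Point restriction commutes with the excision isomorphism of an open subspace: restricting the
excised class `Hₖ(O | K) ≅ Hₖ(X | K) → Hₖ(X | q)` equals excising the restricted class
`Hₖ(O | K) → Hₖ(O | q) ≅ Hₖ(X | q)` (both are induced by the inclusion `O ⊆ X`;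
Hatcher 2002, §3.3 p. 233, naturality of the maps `Hₙ(M | B) → Hₙ(M | y)`). [folklore] -/
theorem restrictToPoint_openSubsetIso_hom [T1Space X] {O K : Set X} (hO : IsOpen O)
    (hK : closure K ⊆ O) (q : ↥O) (hqK : (q : X) ∈ K) (k : ℕ)
    (w : localHomologyOfSet ℤ ℤ (↥O) (Subtype.val ⁻¹' K) k) :
    restrictToPoint ℤ ℤ hqK k ((localHomologyOfSet.openSubsetIso ℤ ℤ hO hK k).hom w) =
      (localHomology.openSubsetIso ℤ ℤ hO q.2 k).hom
        (restrictToPoint ℤ ℤ (show q ∈ Subtype.val ⁻¹' K from hqK) k w) := by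
  have h₁ : MapsTo (subsetIncl O) ((Subtype.val ⁻¹' K)ᶜ : Set ↥O) (Kᶜ : Set X) :=
    localHomologyOfSet.mapsTo_subsetIncl_compl O K
  have h₂ : MapsTo (ContinuousMap.id X) (Kᶜ : Set X) ({(q : X)}ᶜ : Set X) :=
    fun z hz ↦ Set.compl_subset_compl.2 (singleton_subset_iff.2 hqK) hz
  have h₃ : MapsTo (ContinuousMap.id ↥O) ((Subtype.val ⁻¹' K)ᶜ : Set ↥O) ({q}ᶜ : Set ↥O) :=
    fun z hz ↦ Set.compl_subset_compl.2
      (singleton_subset_iff.2 (show q ∈ Subtype.val ⁻¹' K from hqK)) hz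
  have h₄ : MapsTo (subsetIncl O) ({q}ᶜ : Set ↥O) ({(q : X)}ᶜ : Set X) :=
    fun z hz hzq ↦ hz (Subtype.ext hzq)
  have e : relativeSingularHomology.map ℤ ℤ (subsetIncl O) h₁ k ≫
      relativeSingularHomology.map ℤ ℤ (ContinuousMap.id X) h₂ k =
        relativeSingularHomology.map ℤ ℤ (ContinuousMap.id ↥O) h₃ k ≫
          relativeSingularHomology.map ℤ ℤ (subsetIncl O) h₄ k := by
    rw [← relativeSingularHomology.map_comp, ← relativeSingularHomology.map_comp]
    exact map_congr_fun (f := (ContinuousMap.id X).comp (subsetIncl O))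
      (f' := (subsetIncl O).comp (ContinuousMap.id ↥O)) (ContinuousMap.ext fun _ ↦ rfl) _ _ k
  have hw := congrArg (fun φ : localHomologyOfSet ℤ ℤ (↥O) (Subtype.val ⁻¹' K) k ⟶
      localHomology ℤ ℤ X (q : X) k ↦ φ w) e
  simp only [ModuleCat.comp_apply] at hw
  rw [localHomologyOfSet.openSubsetIso, localHomology.openSubsetIso, asIso_hom, asIso_hom]
  exact hw

/-- The same compatibility for the inverse excision isomorphisms. [folklore] -/
theorem restrictToPoint_openSubsetIso_inv [T1Space X] {O K : Set X} (hO : IsOpen O)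
    (hK : closure K ⊆ O) (q : ↥O) (hqK : (q : X) ∈ K) (k : ℕ)
    (w : localHomologyOfSet ℤ ℤ X K k) :
    restrictToPoint ℤ ℤ (show q ∈ Subtype.val ⁻¹' K from hqK) k
        ((localHomologyOfSet.openSubsetIso ℤ ℤ hO hK k).inv w) =
      (localHomology.openSubsetIso ℤ ℤ hO q.2 k).inv (restrictToPoint ℤ ℤ hqK k w) := by
  have h := restrictToPoint_openSubsetIso_hom hO hK q hqK k
    ((localHomologyOfSet.openSubsetIso ℤ ℤ hO hK k).inv w)
  rw [Iso.inv_hom_id_apply] at h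
  rw [h, Iso.hom_inv_id_apply]

/-- Point restriction commutes with the inverse of the cross-universe comparison of local homology
at a set (from the tree's `localHomology.xEquiv_restrictToPoint`). [folklore] -/
theorem xEquiv_symm_restrictToPoint {Y : Type} [TopologicalSpace Y] (e : X ≃ₜ Y) {K : Set X}
    {x : X} (hx : x ∈ K) (k : ℕ) (w : localHomologyOfSet ℤ ℤ Y (e '' K) k) :
    (localHomology.xEquiv ℤ ℤ e x k).symm (restrictToPoint ℤ ℤ (mem_image_of_mem e hx) k w) =
      restrictToPoint ℤ ℤ hx k ((localHomologyOfSet.xEquiv ℤ ℤ e K k).symm w) := by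
  apply (localHomology.xEquiv ℤ ℤ e x k).injective
  rw [LinearEquiv.apply_symm_apply, localHomology.xEquiv_restrictToPoint,
    LinearEquiv.apply_symm_apply]

/-- Point restriction commutes with the map `Hₖ(O | K) → Hₖ(X | K)` induced by the inclusion of
an open subspace `O ⊆ X` (no hypothesis on `K`: the map need not be an isomorphism), landing in
the excision isomorphism at the point (Hatcher 2002, §3.3 p. 233). [folklore] -/
theorem restrictToPoint_map_subsetIncl [T1Space X] {O K : Set X} (hO : IsOpen O) (q : ↥O)
    (hqK : (q : X) ∈ K) (k : ℕ) (w : localHomologyOfSet ℤ ℤ (↥O) (Subtype.val ⁻¹' K) k) :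
    restrictToPoint ℤ ℤ hqK k (relativeSingularHomology.map ℤ ℤ (subsetIncl O)
      (localHomologyOfSet.mapsTo_subsetIncl_compl O K) k w) =
      (localHomology.openSubsetIso ℤ ℤ hO q.2 k).hom
        (restrictToPoint ℤ ℤ (show q ∈ Subtype.val ⁻¹' K from hqK) k w) := by
  have h₂ : MapsTo (ContinuousMap.id X) (Kᶜ : Set X) ({(q : X)}ᶜ : Set X) :=
    fun z hz ↦ Set.compl_subset_compl.2 (singleton_subset_iff.2 hqK) hz
  have h₃ : MapsTo (ContinuousMap.id ↥O) ((Subtype.val ⁻¹' K)ᶜ : Set ↥O) ({q}ᶜ : Set ↥O) :=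
    fun z hz ↦ Set.compl_subset_compl.2
      (singleton_subset_iff.2 (show q ∈ Subtype.val ⁻¹' K from hqK)) hz
  have h₄ : MapsTo (subsetIncl O) ({q}ᶜ : Set ↥O) ({(q : X)}ᶜ : Set X) :=
    fun z hz hzq ↦ hz (Subtype.ext hzq)
  have e : relativeSingularHomology.map ℤ ℤ (subsetIncl O)
      (localHomologyOfSet.mapsTo_subsetIncl_compl O K) k ≫
      relativeSingularHomology.map ℤ ℤ (ContinuousMap.id X) h₂ k =
        relativeSingularHomology.map ℤ ℤ (ContinuousMap.id ↥O) h₃ k ≫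
          relativeSingularHomology.map ℤ ℤ (subsetIncl O) h₄ k := by
    rw [← relativeSingularHomology.map_comp, ← relativeSingularHomology.map_comp]
    exact map_congr_fun (f := (ContinuousMap.id X).comp (subsetIncl O))
      (f' := (subsetIncl O).comp (ContinuousMap.id ↥O)) (ContinuousMap.ext fun _ ↦ rfl) _ _ k
  have hw := congrArg (fun φ : localHomologyOfSet ℤ ℤ (↥O) (Subtype.val ⁻¹' K) k ⟶
      localHomology ℤ ℤ X (q : X) k ↦ φ w) e
  simp only [ModuleCat.comp_apply] at hw
  rw [localHomology.openSubsetIso, asIso_hom]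
  exact hw

/-! On the manifold `X` only the `T₁` separation of charted spaces over `ℝⁿ`
(`ChartedSpace.t1Space`) is used: point excision `Hₖ(U | y) ≅ Hₖ(X | y)` needs `{y}` closed, and
the neighbourhood classes are pushed along `U ⊆ X` by the plain induced map. -/

variable [T1Space X]

/-- A chart restricted to an open subset `U` of its source, as a homeomorphism `U ≃ₜ c(U)`.
[folklore] -/
abbrev chartHomeo (c : OpenPartialHomeomorph X (𝔼 n)) {U : Set X} (hUc : U ⊆ c.source) :
    ↥U ≃ₜ ↥(c '' U) :=
  c.homeomorphOfImageSubsetSource hUc rfl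

/-- **Transport of local homology along a chart**: for a chart `c` of `X`, an open `U ⊆ c.source`
and `y ∈ U`, the identification `Θ(c, U, y) : Hₖ(X | y; ℤ) ≃ Hₖ(ℝⁿ | c y; ℤ)` — excision to `U`,
the homeomorphism `U ≃ₜ c(U)` across universes, excision from `c(U)` to `ℝⁿ` (Hatcher 2002, §3.3,
p. 231: "`Hₙ(M | x) ≅ Hₙ(ℝⁿ | x)` by excision"; the tree's `localHomology.chartXEquiv` is the case
`U = c.source`). [cite: HatcherAT2002, §3.3 p. 231] -/
def chartTransport (c : OpenPartialHomeomorph X (𝔼 n)) {U : Set X} (hU : IsOpen U)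
    (hUc : U ⊆ c.source) {y : X} (hy : y ∈ U) (k : ℕ) :
    localHomology ℤ ℤ X y k ≃ₗ[ℤ] localHomology ℤ ℤ (𝔼 n) (c y) k :=
  (localHomology.openSubsetIso ℤ ℤ hU hy k).symm.toLinearEquiv ≪≫ₗ
    (localHomology.xEquiv ℤ ℤ (chartHomeo c hUc) ⟨y, hy⟩ k ≪≫ₗ
      (localHomology.openSubsetIso ℤ ℤ (c.isOpen_image_of_subset_source hU hUc)
        (mem_image_of_mem c hy) k).toLinearEquiv)

/-- Unfolding `chartTransport`. [folklore] -/
theorem chartTransport_apply (c : OpenPartialHomeomorph X (𝔼 n)) {U : Set X} (hU : IsOpen U)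
    (hUc : U ⊆ c.source) {y : X} (hy : y ∈ U) (k : ℕ) (z : localHomology ℤ ℤ X y k) :
    chartTransport c hU hUc hy k z =
      (localHomology.openSubsetIso ℤ ℤ (c.isOpen_image_of_subset_source hU hUc)
        (mem_image_of_mem c hy) k).hom
        (localHomology.xEquiv ℤ ℤ (chartHomeo c hUc) ⟨y, hy⟩ k
          ((localHomology.openSubsetIso ℤ ℤ hU hy k).inv z)) :=
  rfl

/-- Unfolding the inverse of `chartTransport`. [folklore] -/
theorem chartTransport_symm_apply (c : OpenPartialHomeomorph X (𝔼 n)) {U : Set X} (hU : IsOpen U)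
    (hUc : U ⊆ c.source) {y : X} (hy : y ∈ U) (k : ℕ)
    (v : localHomology ℤ ℤ (𝔼 n) (c y) k) :
    (chartTransport c hU hUc hy k).symm v =
      (localHomology.openSubsetIso ℤ ℤ hU hy k).hom
        ((localHomology.xEquiv ℤ ℤ (chartHomeo c hUc) ⟨y, hy⟩ k).symm
          ((localHomology.openSubsetIso ℤ ℤ (c.isOpen_image_of_subset_source hU hUc)
            (mem_image_of_mem c hy) k).inv v)) :=
  rfl

/-- **Shrinking the open set does not change the transport** (naturality of excision and of the
cross-universe comparison under the inclusions `U ⊆ U'`, `c(U) ⊆ c(U')`). [folklore] -/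
theorem chartTransport_mono (c : OpenPartialHomeomorph X (𝔼 n)) {U U' : Set X} (hU : IsOpen U)
    (hU' : IsOpen U') (hUU' : U ⊆ U') (hU'c : U' ⊆ c.source) {y : X} (hy : y ∈ U) (k : ℕ)
    (z : localHomology ℤ ℤ X y k) :
    chartTransport c hU (hUU'.trans hU'c) hy k z = chartTransport c hU' hU'c (hUU' hy) k z := by
  have hVV' : c '' U ⊆ c '' U' := image_mono hUU'
  have hf : MapsTo (⟨inclusion hUU', continuous_inclusion hUU'⟩ : C(↥U, ↥U'))
      ({(⟨y, hy⟩ : ↥U)}ᶜ : Set ↥U) ({(⟨y, hUU' hy⟩ : ↥U')}ᶜ : Set ↥U') :=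
    mapsTo_compl_singleton_of_injective (inclusion_injective hUU') (Subtype.ext rfl)
  have hg : MapsTo (⟨inclusion hVV', continuous_inclusion hVV'⟩ : C(↥(c '' U), ↥(c '' U')))
      ({chartHomeo c (hUU'.trans hU'c) ⟨y, hy⟩}ᶜ : Set ↥(c '' U))
      ({chartHomeo c hU'c ⟨y, hUU' hy⟩}ᶜ : Set ↥(c '' U')) :=
    mapsTo_compl_singleton_of_injective (inclusion_injective hVV') (Subtype.ext rfl)
  -- naturality of `xEquiv`
  have hnat : ∀ w : localHomology ℤ ℤ (↥U) ⟨y, hy⟩ k,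
      localHomology.xEquiv ℤ ℤ (chartHomeo c hU'c) ⟨y, hUU' hy⟩ k
        (relativeSingularHomology.map ℤ ℤ _ hf k w) =
        relativeSingularHomology.map ℤ ℤ _ hg k
          (localHomology.xEquiv ℤ ℤ (chartHomeo c (hUU'.trans hU'c)) ⟨y, hy⟩ k w) := fun w ↦
    relativeSingularHomology.xEquiv_map ℤ ℤ (chartHomeo c (hUU'.trans hU'c)) (chartHomeo c hU'c)
      _ _ (fun u ↦ Subtype.ext rfl) _ _ _ _ hf hg k w
  -- the two excisions on the `X` side
  have hXU : MapsTo (subsetIncl U) ({(⟨y, hy⟩ : ↥U)}ᶜ : Set ↥U) ({y}ᶜ : Set X) :=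
    fun w hw hwy ↦ hw (Subtype.ext hwy)
  have hXU' : MapsTo (subsetIncl U') ({(⟨y, hUU' hy⟩ : ↥U')}ᶜ : Set ↥U') ({y}ᶜ : Set X) :=
    fun w hw hwy ↦ hw (Subtype.ext hwy)
  have hX : relativeSingularHomology.map ℤ ℤ _ hf k ≫
      (localHomology.openSubsetIso ℤ ℤ hU' (hUU' hy) k).hom =
        (localHomology.openSubsetIso ℤ ℤ hU hy k).hom := by
    rw [localHomology.openSubsetIso, localHomology.openSubsetIso, asIso_hom, asIso_hom]
    exact (relativeSingularHomology.map_comp ℤ ℤ _ (subsetIncl U') hf hXU' k).symm.trans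
      (map_congr_fun (f' := subsetIncl U) (ContinuousMap.ext fun _ ↦ rfl) _ hXU k)
  have hX' : relativeSingularHomology.map ℤ ℤ _ hf k
      ((localHomology.openSubsetIso ℤ ℤ hU hy k).inv z) =
      (localHomology.openSubsetIso ℤ ℤ hU' (hUU' hy) k).inv z := by
    have h1 := congrArg (fun φ : localHomology ℤ ℤ (↥U) ⟨y, hy⟩ k ⟶ localHomology ℤ ℤ X y k ↦
      φ ((localHomology.openSubsetIso ℤ ℤ hU hy k).inv z)) hX
    simp only [ModuleCat.comp_apply, Iso.inv_hom_id_apply] at h1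
    calc relativeSingularHomology.map ℤ ℤ _ hf k ((localHomology.openSubsetIso ℤ ℤ hU hy k).inv z)
        = (localHomology.openSubsetIso ℤ ℤ hU' (hUU' hy) k).inv
            ((localHomology.openSubsetIso ℤ ℤ hU' (hUU' hy) k).hom
              (relativeSingularHomology.map ℤ ℤ _ hf k
                ((localHomology.openSubsetIso ℤ ℤ hU hy k).inv z))) :=
          (Iso.hom_inv_id_apply _ _).symm
      _ = (localHomology.openSubsetIso ℤ ℤ hU' (hUU' hy) k).inv z := by rw [h1]
  -- the two excisions on the `ℝⁿ` side
  have hV : IsOpen (c '' U) := c.isOpen_image_of_subset_source hU (hUU'.trans hU'c)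
  have hV' : IsOpen (c '' U') := c.isOpen_image_of_subset_source hU' hU'c
  have hEV : MapsTo (subsetIncl (c '' U))
      ({chartHomeo c (hUU'.trans hU'c) ⟨y, hy⟩}ᶜ : Set ↥(c '' U)) ({c y}ᶜ : Set (𝔼 n)) :=
    fun w hw hwy ↦ hw (Subtype.ext hwy)
  have hEV' : MapsTo (subsetIncl (c '' U')) ({chartHomeo c hU'c ⟨y, hUU' hy⟩}ᶜ : Set ↥(c '' U'))
      ({c y}ᶜ : Set (𝔼 n)) :=
    fun w hw hwy ↦ hw (Subtype.ext hwy)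
  have hE : relativeSingularHomology.map ℤ ℤ _ hg k ≫
      (localHomology.openSubsetIso ℤ ℤ hV' (mem_image_of_mem c (hUU' hy)) k).hom =
        (localHomology.openSubsetIso ℤ ℤ hV (mem_image_of_mem c hy) k).hom := by
    rw [localHomology.openSubsetIso, localHomology.openSubsetIso, asIso_hom, asIso_hom]
    exact (relativeSingularHomology.map_comp ℤ ℤ _ (subsetIncl (c '' U')) hg hEV' k).symm.trans
      (map_congr_fun (f' := subsetIncl (c '' U)) (ContinuousMap.ext fun _ ↦ rfl) _ hEV k)
  rw [chartTransport_apply, chartTransport_apply, ← hX', hnat]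
  have h2 := congrArg (fun φ : localHomology ℤ ℤ (↥(c '' U))
      (chartHomeo c (hUU'.trans hU'c) ⟨y, hy⟩) k ⟶ localHomology ℤ ℤ (𝔼 n) (c y) k ↦
        φ (localHomology.xEquiv ℤ ℤ (chartHomeo c (hUU'.trans hU'c)) ⟨y, hy⟩ k
          ((localHomology.openSubsetIso ℤ ℤ hU hy k).inv z))) hE
  simp only [ModuleCat.comp_apply] at h2
  exact h2.symm

/-- The change of charts `c(U) → c'(U)` between the images of a common open subset `U` of the two
chart sources, as a homeomorphism. [folklore] -/
abbrev chartChange (c c' : OpenPartialHomeomorph X (𝔼 n)) {U : Set X} (hUc : U ⊆ c.source)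
    (hUc' : U ⊆ c'.source) : ↥(c '' U) ≃ₜ ↥(c' '' U) :=
  (chartHomeo c hUc).symm.trans (chartHomeo c' hUc')

/-- **The transports along two charts differ by the chart change**: for charts `c, c'` and an open
`U` inside both sources, `Θ(c', U, y) = (excision) ∘ (c' ∘ c⁻¹)_* ∘ (excision)⁻¹ ∘ Θ(c, U, y)`
(naturality of the cross-universe comparison, the tree's `relativeSingularHomology.xEquiv_map`).
[folklore] -/
theorem chartTransport_trans (c c' : OpenPartialHomeomorph X (𝔼 n)) {U : Set X} (hU : IsOpen U)
    (hUc : U ⊆ c.source) (hUc' : U ⊆ c'.source) {y : X} (hy : y ∈ U) (k : ℕ)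
    (h : MapsTo (chartChange c c' hUc hUc') ({chartHomeo c hUc ⟨y, hy⟩}ᶜ : Set ↥(c '' U))
      {chartHomeo c' hUc' ⟨y, hy⟩}ᶜ)
    (z : localHomology ℤ ℤ X y k) :
    chartTransport c' hU hUc' hy k z =
      (localHomology.openSubsetIso ℤ ℤ (c'.isOpen_image_of_subset_source hU hUc')
        (mem_image_of_mem c' hy) k).hom
        (relativeSingularHomology.map ℤ ℤ (chartChange c c' hUc hUc' : C(↥(c '' U), ↥(c' '' U)))
          h k ((localHomology.openSubsetIso ℤ ℤ (c.isOpen_image_of_subset_source hU hUc)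
            (mem_image_of_mem c hy) k).inv (chartTransport c hU hUc hy k z))) := by
  have hnat : ∀ w : localHomology ℤ ℤ (↥U) ⟨y, hy⟩ k,
      localHomology.xEquiv ℤ ℤ (chartHomeo c' hUc') ⟨y, hy⟩ k
        (relativeSingularHomology.map ℤ ℤ (ContinuousMap.id ↥U) (mapsTo_id _) k w) =
        relativeSingularHomology.map ℤ ℤ (chartChange c c' hUc hUc' : C(↥(c '' U), ↥(c' '' U)))
          h k (localHomology.xEquiv ℤ ℤ (chartHomeo c hUc) ⟨y, hy⟩ k w) := fun w ↦
    relativeSingularHomology.xEquiv_map ℤ ℤ (chartHomeo c hUc) (chartHomeo c' hUc')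
      (ContinuousMap.id ↥U)
      (chartChange c c' hUc hUc' : C(↥(c '' U), ↥(c' '' U)))
      (fun u ↦ by
        apply Subtype.ext
        show c' (c.symm (c u)) = c' u
        rw [c.left_inv (hUc u.2)]) _ _ _ _ (mapsTo_id _) h k w
  rw [chartTransport_apply, chartTransport_apply, Iso.hom_inv_id_apply, ← hnat,
    relativeSingularHomology.map_id]
  rfl

end ChartTransport

/-! ### The reflection of `ℝⁿ` and the oriented reference classes -/

section Reflection

variable (n) in
/-- The diagonal of the reflection in the first coordinate hyperplane: `(-1, 1, …, 1)` (empty for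
`n = 0`). [folklore] -/
def reflDiag : Fin n → ℝ := fun i ↦ if (i : ℕ) = 0 then -1 else 1

/-- `reflDiag` squares to `1`. [folklore] -/
theorem reflDiag_mul_self (i : Fin n) : reflDiag n i * reflDiag n i = 1 := by
  unfold reflDiag
  split_ifs <;> norm_num

/-- The reflection `r` of `ℝⁿ` in the hyperplane `x₀ = 0` (the identity for `n = 0`), a linear
map of determinant `-1` for `n ≥ 1` (Hirsch, *Differential Topology*, §4.4; Milnor–Stasheff 1974,
Appendix A: "reflection reverses orientation" — a fact deliberately NOT used below). [folklore] -/
def reflE : 𝔼 n →L[ℝ] 𝔼 n := linE (Matrix.diagonal (reflDiag n))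

/-- `r ∘ r = id`. [folklore] -/
@[simp] theorem reflE_reflE (z : 𝔼 n) : reflE (reflE z) = z := by
  rw [reflE, ← linE_mul_apply, Matrix.diagonal_mul_diagonal]
  have : (Matrix.diagonal fun i ↦ reflDiag n i * reflDiag n i) =
      (1 : Matrix (Fin n) (Fin n) ℝ) := by
    rw [← Matrix.diagonal_one]
    congr 1
    funext i
    exact reflDiag_mul_self i
  rw [this, linE_one_apply]

/-- `det r · det r = 1`. [folklore] -/
theorem det_reflE_mul_self : (reflE (n := n)).det * (reflE (n := n)).det = 1 := by
  have h : (reflE (n := n)).comp reflE = ContinuousLinearMap.id ℝ (𝔼 n) :=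
    ContinuousLinearMap.ext reflE_reflE
  have h' := congrArg ContinuousLinearMap.det h
  rw [ContinuousLinearMap.det, ContinuousLinearMap.det, ContinuousLinearMap.coe_id,
    LinearMap.det_id] at h'
  rw [← h']
  exact (LinearMap.det_comp _ _).symm

/-- `det r = -1` for `n ≥ 1`. [folklore] -/
theorem det_reflE (hn : 0 < n) : (reflE (n := n)).det = -1 := by
  rw [reflE, det_linE, Matrix.det_diagonal]
  obtain ⟨m, rfl⟩ : ∃ m, n = m + 1 := ⟨n - 1, by omega⟩
  rw [Fin.prod_univ_succ]
  have h0 : reflDiag (m + 1) 0 = -1 := if_pos rfl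
  have hs : ∀ i : Fin m, reflDiag (m + 1) i.succ = 1 := fun i ↦ if_neg (by simp)
  simp [h0, hs]

/-- The reflection as a homeomorphism of `ℝⁿ` (its own inverse). [folklore] -/
def reflHomeo : 𝔼 n ≃ₜ 𝔼 n where
  toFun := reflE
  invFun := reflE
  left_inv := reflE_reflE
  right_inv := reflE_reflE
  continuous_toFun := (reflE (n := n)).continuous
  continuous_invFun := (reflE (n := n)).continuous

/-- Values of `reflHomeo`. [folklore] -/
@[simp] theorem reflHomeo_apply (z : 𝔼 n) : reflHomeo z = reflE z := rfl

/-- Values of `reflHomeo.symm`. [folklore] -/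
@[simp] theorem reflHomeo_symm_apply (z : 𝔼 n) : (reflHomeo (n := n)).symm z = reflE z := rfl

variable {X : Type u} [TopologicalSpace X] [ChartedSpace (𝔼 n) X] [IsManifold (𝓡 n) 1 X]

open Classical in
/-- **The orienting homeomorphism attached to a point** of a smoothly oriented manifold: the
identity if the preferred chart at `y` is positively oriented (`o y` is the standard orientation
of `ℝⁿ`), the reflection `r` otherwise — composing the chart with it yields an oriented atlas
(Hirsch, *Differential Topology*, §4.4; Bredon 1993, VI.7). [folklore] -/
def Rh (o : SmoothOrientation (𝓡 n) X) (y : X) : 𝔼 n ≃ₜ 𝔼 n :=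
  if o y = euclideanOrientation n then Homeomorph.refl (𝔼 n) else reflHomeo

open Classical in
/-- The linear map underlying `Rh o y` (and its inverse). [folklore] -/
def Rl (o : SmoothOrientation (𝓡 n) X) (y : X) : 𝔼 n →L[ℝ] 𝔼 n :=
  if o y = euclideanOrientation n then ContinuousLinearMap.id ℝ (𝔼 n) else reflE

/-- `Rh o y` is the linear map `Rl o y`. [folklore] -/
theorem Rh_apply (o : SmoothOrientation (𝓡 n) X) (y : X) (z : 𝔼 n) : Rh o y z = Rl o y z := by
  unfold Rh Rl
  split_ifs <;> rfl

/-- `(Rh o y)⁻¹` is the linear map `Rl o y` (both maps are involutions). [folklore] -/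
theorem Rh_symm_apply (o : SmoothOrientation (𝓡 n) X) (y : X) (z : 𝔼 n) :
    (Rh o y).symm z = Rl o y z := by
  unfold Rh Rl
  split_ifs <;> rfl

/-- **The oriented reference orientation of `ℝⁿ` at `y`**: `μ_E` transported along `Rh o y`
(i.e. `μ_E` itself for positively oriented charts). [folklore] -/
abbrev μR (o : SmoothOrientation (𝓡 n) X) (y : X) : HomologicalOrientation ℤ (𝔼 n) n :=
  (μE n).comap (Rh o y)

variable [T1Space X]

/-- **The candidate local orientation class at `y`**: the local class at `c y` of the oriented
reference orientation, carried back along the preferred chart `c = chartAt y`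
(Bredon 1993, VI.7, Prop. 7.14–Thm. 7.15; Milnor–Stasheff 1974, Appendix A: "the preferred
generator in a positively oriented coordinate neighbourhood").
[cite: MilnorStasheff1974, Appendix A] -/
def localClassX (o : SmoothOrientation (𝓡 n) X) (y : X) : localHomology ℤ ℤ X y n :=
  (chartTransport (chartAt (𝔼 n) y) (chartAt (𝔼 n) y).open_source subset_rfl
    (mem_chart_source (𝔼 n) y) n).symm ((μR o y).localClass (chartAt (𝔼 n) y y))

end Reflection

/-! ### The chart change between oriented charts acts correctly on the reference classes -/

section ChartChangeStep

variable {X : Type u} [TopologicalSpace X] [ChartedSpace (𝔼 n) X] [IsManifold (𝓡 n) 1 X]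

/-- The coordinate changes `y → x` and `x → y` at `y` are mutually inverse. [folklore] -/
theorem tangentCoordChange_inv {x y : X} (hy : y ∈ (chartAt (𝔼 n) x).source) (v : 𝔼 n) :
    tangentCoordChange (𝓡 n) y x y (tangentCoordChange (𝓡 n) x y y v) = v := by
  have hy' : y ∈ (extChartAt (𝓡 n) x).source := by rwa [extChartAt_source]
  have hyy : y ∈ (extChartAt (𝓡 n) y).source := by
    rw [extChartAt_source]; exact mem_chart_source _ y
  rw [tangentCoordChange_comp ⟨⟨hy', hyy⟩, hy'⟩, tangentCoordChange_self hy']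

/-- The chart change `c_y ∘ c_x⁻¹` is differentiable at `c_x y` with derivative the coordinate
change `tangentCoordChange (𝓡 n) x y y` (Mathlib's `hasFDerivWithinAt_tangentCoordChange`, for the
boundaryless model `𝓡 n`). [folklore] -/
theorem hasFDerivAt_chartChange {x y : X} (hy : y ∈ (chartAt (𝔼 n) x).source) :
    HasFDerivAt (fun v ↦ chartAt (𝔼 n) y ((chartAt (𝔼 n) x).symm v))
      (tangentCoordChange (𝓡 n) x y y) (chartAt (𝔼 n) x y) := by
  have hy' : y ∈ (extChartAt (𝓡 n) x).source := by rwa [extChartAt_source]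
  have hyy : y ∈ (extChartAt (𝓡 n) y).source := by
    rw [extChartAt_source]; exact mem_chart_source _ y
  have h := hasFDerivWithinAt_tangentCoordChange (x := x) (y := y) (z := y) ⟨hy', hyy⟩
  rw [ModelWithCorners.range_eq_univ, hasFDerivWithinAt_univ] at h
  have e1 : (extChartAt (𝓡 n) y) ∘ (extChartAt (𝓡 n) x).symm =
      fun v ↦ chartAt (𝔼 n) y ((chartAt (𝔼 n) x).symm v) := by
    ext v
    simp
  have e2 : extChartAt (𝓡 n) x y = chartAt (𝔼 n) x y := by simp
  rwa [e1, e2] at h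

variable [T1Space X] (o : SmoothOrientation (𝓡 n) X)

/-- **The chart-change step.** For `y` in the chart domain of `x`, if the linear map
`Rl o y ∘ D(c_y ∘ c_x⁻¹)(c_x y) ∘ Rl o x` has positive determinant, then the class at `y` built
from the chart at `x` and the reference orientation `μR o x` coincides, after transport to the
chart at `y`, with the reference class of `μR o y` at `c_y y`: transports along the two charts
differ by the chart change (`chartTransport_trans`), which acts as its affine approximation
(`openSubsetIso_map_eq_map_affine`), which carries `μR o x` to `μR o y`
(`map_affineApprox_comap`). This is the heart of Bredon 1993, VI.7, Thm. 7.15 /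
Milnor–Stasheff 1974, Appendix A (positively related charts induce the same preferred generator).
[cite: MilnorStasheff1974, Appendix A] -/
theorem chartTransport_symm_μR (x y : X) (hy : y ∈ (chartAt (𝔼 n) x).source)
    (hdet : 0 < ((Rl o y).comp ((tangentCoordChange (𝓡 n) x y y).comp (Rl o x))).det) :
    chartTransport (chartAt (𝔼 n) y) (chartAt (𝔼 n) y).open_source subset_rfl
        (mem_chart_source (𝔼 n) y) n
      ((chartTransport (chartAt (𝔼 n) x) (chartAt (𝔼 n) x).open_source subset_rfl hy n).symm
        ((μR o x).localClass (chartAt (𝔼 n) x y))) =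
      (μR o y).localClass (chartAt (𝔼 n) y y) := by
  -- the common open set
  have hU : IsOpen ((chartAt (𝔼 n) x).source ∩ (chartAt (𝔼 n) y).source) :=
    (chartAt (𝔼 n) x).open_source.inter (chartAt (𝔼 n) y).open_source
  have hyU : y ∈ (chartAt (𝔼 n) x).source ∩ (chartAt (𝔼 n) y).source :=
    ⟨hy, mem_chart_source _ y⟩
  have hmx : chartTransport (chartAt (𝔼 n) x) hU inter_subset_left hyU n =
      chartTransport (chartAt (𝔼 n) x) (chartAt (𝔼 n) x).open_source subset_rfl hy n :=
    LinearEquiv.ext fun z ↦ chartTransport_mono (chartAt (𝔼 n) x) hU (chartAt (𝔼 n) x).open_source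
      inter_subset_left subset_rfl hyU n z
  have hmy : chartTransport (chartAt (𝔼 n) y) hU inter_subset_right hyU n =
      chartTransport (chartAt (𝔼 n) y) (chartAt (𝔼 n) y).open_source subset_rfl
        (mem_chart_source (𝔼 n) y) n :=
    LinearEquiv.ext fun z ↦ chartTransport_mono (chartAt (𝔼 n) y) hU (chartAt (𝔼 n) y).open_source
      inter_subset_right subset_rfl hyU n z
  rw [← hmx, ← hmy]
  -- the points of the two chart images, as elements of the subtypes
  set x₀ : ↥((chartAt (𝔼 n) x) '' ((chartAt (𝔼 n) x).source ∩ (chartAt (𝔼 n) y).source)) :=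
    chartHomeo (chartAt (𝔼 n) x) inter_subset_left ⟨y, hyU⟩ with hx₀
  set y₀ : ↥((chartAt (𝔼 n) y) '' ((chartAt (𝔼 n) x).source ∩ (chartAt (𝔼 n) y).source)) :=
    chartHomeo (chartAt (𝔼 n) y) inter_subset_right ⟨y, hyU⟩ with hy₀
  have hx₀v : (x₀ : 𝔼 n) = chartAt (𝔼 n) x y := rfl
  have hy₀v : (y₀ : 𝔼 n) = chartAt (𝔼 n) y y := rfl
  -- the chart change and its properties
  have hg₀ : Injective (chartChange (chartAt (𝔼 n) x) (chartAt (𝔼 n) y) inter_subset_left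
      inter_subset_right (U := (chartAt (𝔼 n) x).source ∩ (chartAt (𝔼 n) y).source)) :=
    Homeomorph.injective _
  have hG : ∀ w : ↥((chartAt (𝔼 n) x) '' ((chartAt (𝔼 n) x).source ∩ (chartAt (𝔼 n) y).source)),
      (chartChange (chartAt (𝔼 n) x) (chartAt (𝔼 n) y) inter_subset_left inter_subset_right w :
        𝔼 n) =
        (fun v ↦ chartAt (𝔼 n) y ((chartAt (𝔼 n) x).symm v)) w := fun w ↦ rfl
  have hb : (fun v ↦ chartAt (𝔼 n) y ((chartAt (𝔼 n) x).symm v)) x₀ = y₀ := by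
    show chartAt (𝔼 n) y ((chartAt (𝔼 n) x).symm (chartAt (𝔼 n) x y)) = chartAt (𝔼 n) y y
    rw [(chartAt (𝔼 n) x).left_inv hy]
  have hb' : chartChange (chartAt (𝔼 n) x) (chartAt (𝔼 n) y) inter_subset_left inter_subset_right
      x₀ = y₀ := Subtype.ext hb
  have hA : Injective (tangentCoordChange (𝓡 n) x y y) := fun v w hvw ↦ by
    have h1 := congrArg (tangentCoordChange (𝓡 n) y x y) hvw
    rwa [tangentCoordChange_inv hy, tangentCoordChange_inv hy] at h1
  have h : MapsTo (chartChange (chartAt (𝔼 n) x) (chartAt (𝔼 n) y) inter_subset_left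
      inter_subset_right) ({x₀}ᶜ : Set _) {y₀}ᶜ :=
    mapsTo_compl_singleton_of_injective hg₀ hb'
  have h' : MapsTo (affineApprox (y₀ : 𝔼 n) (x₀ : 𝔼 n) (tangentCoordChange (𝓡 n) x y y))
      ({(x₀ : 𝔼 n)}ᶜ : Set (𝔼 n)) {(y₀ : 𝔼 n)}ᶜ := by
    refine mapsTo_compl_singleton_of_injective (fun v w hvw ↦ ?_) (by simp)
    have h1 : tangentCoordChange (𝓡 n) x y y (v - x₀) = tangentCoordChange (𝓡 n) x y y (w - x₀) :=
      add_left_cancel hvw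
    exact sub_left_injective (hA h1)
  rw [chartTransport_trans (chartAt (𝔼 n) x) (chartAt (𝔼 n) y) hU inter_subset_left
    inter_subset_right hyU n h, LinearEquiv.apply_symm_apply]
  have hE := openSubsetIso_map_eq_map_affine
    ((chartAt (𝔼 n) x).isOpen_image_of_subset_source hU inter_subset_left)
    ((chartAt (𝔼 n) y).isOpen_image_of_subset_source hU inter_subset_right)
    (chartChange (chartAt (𝔼 n) x) (chartAt (𝔼 n) y) inter_subset_left inter_subset_right)
    hg₀ hG x₀ y₀ (hasFDerivAt_chartChange (x := x) (y := y) hy) hA hb h h' n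
    ((localHomology.openSubsetIso ℤ ℤ
      ((chartAt (𝔼 n) x).isOpen_image_of_subset_source hU inter_subset_left) x₀.2 n).inv
        ((μR o x).localClass (chartAt (𝔼 n) x y)))
  rw [Iso.inv_hom_id_apply] at hE
  exact hE.trans (map_affineApprox_comap (Rh o x) (Rh o y) (Rl o x) (Rl o y) (Rh_symm_apply o x)
    (Rh_apply o y) _ _ _ hdet h')

end ChartChangeStep

/-! ### Sign analysis: oriented charts overlap positively -/

section SignAnalysis

variable {X : Type u} [TopologicalSpace X] [ChartedSpace (𝔼 n) X] [IsManifold (𝓡 n) 1 X]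
  (o : SmoothOrientation (𝓡 n) X)

/-- Determinant of a triple composite. [folklore] -/
theorem det_comp₃ (A B C : 𝔼 n →L[ℝ] 𝔼 n) :
    (A.comp (B.comp C)).det = A.det * (B.det * C.det) := by
  show LinearMap.det ((A : 𝔼 n →ₗ[ℝ] 𝔼 n) ∘ₗ ((B : 𝔼 n →ₗ[ℝ] 𝔼 n) ∘ₗ (C : 𝔼 n →ₗ[ℝ] 𝔼 n))) = _
  rw [LinearMap.det_comp, LinearMap.det_comp]

/-- The identity has determinant `1`. [folklore] -/
theorem det_id_clm : (ContinuousLinearMap.id ℝ (𝔼 n)).det = 1 := by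
  rw [ContinuousLinearMap.det, ContinuousLinearMap.coe_id, LinearMap.det_id]

/-- The determinants of the two coordinate changes at `y` multiply to `1`. [folklore] -/
theorem det_tangentCoordChange_mul {x y : X} (hy : y ∈ (chartAt (𝔼 n) x).source) :
    (tangentCoordChange (𝓡 n) y x y).det * (tangentCoordChange (𝓡 n) x y y).det = 1 := by
  have h : (tangentCoordChange (𝓡 n) y x y).comp (tangentCoordChange (𝓡 n) x y y) =
      ContinuousLinearMap.id ℝ (𝔼 n) :=
    ContinuousLinearMap.ext (tangentCoordChange_inv hy)
  have h' := congrArg ContinuousLinearMap.det h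
  rw [det_id_clm] at h'
  rw [← h']
  exact (LinearMap.det_comp _ _).symm

/-- **Oriented charts overlap positively.** If at `y` (in the chart domain of `x`) the smooth
orientation satisfies its defining relation "`o y = o x` iff the coordinate change `x → y` has
positive Jacobian", then the linear map `Rl o y ∘ D(c_y ∘ c_x⁻¹)(c_x y) ∘ Rl o x` — the Jacobian of
the change between the *oriented* charts `Rh o x ∘ c_x` and `Rh o y ∘ c_y` — has positive
determinant (Hirsch, *Differential Topology*, §4.4: an orientation defines an oriented atlas;
four sign cases, using only `det r = -1` for `n ≥ 1`, `det r · det r = 1`, and that `ℝⁿ` has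
exactly two orientations). [folklore] -/
theorem det_pos_of_iff {x y : X} (hy : y ∈ (chartAt (𝔼 n) x).source)
    (hiff : o y = o x ↔ 0 < LinearMap.det
      ((tangentCoordChange (𝓡 n) y x y : 𝔼 n →L[ℝ] 𝔼 n) : 𝔼 n →ₗ[ℝ] 𝔼 n)) :
    0 < ((Rl o y).comp ((tangentCoordChange (𝓡 n) x y y).comp (Rl o x))).det := by
  change o y = o x ↔ 0 < (tangentCoordChange (𝓡 n) y x y).det at hiff
  rw [det_comp₃]
  have hprod := det_tangentCoordChange_mul (n := n) hy
  have hpos : 0 < (tangentCoordChange (𝓡 n) y x y).det * (tangentCoordChange (𝓡 n) x y y).det := by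
    rw [hprod]
    exact one_pos
  have hcard : Fintype.card (Fin (Module.finrank ℝ (𝔼 n))) = Module.finrank ℝ (𝔼 n) :=
    Fintype.card_fin _
  have h2y := Orientation.eq_or_eq_neg (o y) (euclideanOrientation n) hcard
  have h2x := Orientation.eq_or_eq_neg (o x) (euclideanOrientation n) hcard
  have hrr := det_reflE_mul_self (n := n)
  rcases mul_pos_iff.1 hpos with ⟨hb, ha⟩ | ⟨hb, ha⟩
  · -- both Jacobians positive: `o y = o x`
    have hyx : o y = o x := hiff.2 hb
    by_cases hx : o x = euclideanOrientation n
    · have hy' : o y = euclideanOrientation n := hyx.trans hx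
      have hRx : Rl o x = ContinuousLinearMap.id ℝ (𝔼 n) := if_pos hx
      have hRy : Rl o y = ContinuousLinearMap.id ℝ (𝔼 n) := if_pos hy'
      rw [hRx, hRy, det_id_clm]
      linarith
    · have hy' : o y ≠ euclideanOrientation n := fun h ↦ hx (hyx ▸ h)
      have hRx : Rl o x = reflE := if_neg hx
      have hRy : Rl o y = reflE := if_neg hy'
      rw [hRx, hRy]
      nlinarith
  · -- both Jacobians negative: `o y ≠ o x`, and `n ≥ 1`
    have hyx : o y ≠ o x := fun h ↦ absurd (hiff.1 h) (not_lt.2 hb.le)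
    have hn : 0 < n := by
      rcases Nat.eq_zero_or_pos n with hn0 | hn0
      · exfalso
        have h0 : Module.finrank ℝ (𝔼 n) = 0 := by
          rw [finrank_euclideanSpace_fin, hn0]
        have : (tangentCoordChange (𝓡 n) x y y).det = 1 :=
          LinearMap.det_eq_one_of_finrank_eq_zero h0 _
        linarith
      · exact hn0
    have hr : (reflE (n := n)).det = -1 := det_reflE hn
    by_cases hx : o x = euclideanOrientation n
    · have hy' : o y ≠ euclideanOrientation n := fun h ↦ hyx (h.trans hx.symm)
      have hRx : Rl o x = ContinuousLinearMap.id ℝ (𝔼 n) := if_pos hx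
      have hRy : Rl o y = reflE := if_neg hy'
      rw [hRx, hRy, det_id_clm, hr]
      nlinarith
    · have hx' : o x = -euclideanOrientation n := h2x.resolve_left hx
      have hy' : o y = euclideanOrientation n := by
        rcases h2y with h | h
        · exact h
        · exact absurd (h.trans hx'.symm) hyx
      have hRx : Rl o x = reflE := if_neg hx
      have hRy : Rl o y = ContinuousLinearMap.id ℝ (𝔼 n) := if_pos hy'
      rw [hRx, hRy, det_id_clm, hr]
      nlinarith

end SignAnalysis

/-! ### Assembly: the homological orientation attached to a smooth orientation -/

section Assembly

variable {X : Type u} [TopologicalSpace X] [T1Space X] [ChartedSpace (𝔼 n) X]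
  [IsManifold (𝓡 n) 1 X] (o : SmoothOrientation (𝓡 n) X)

/-- **Local consistency of the candidate local classes** (Bredon 1993, VI.7, proof of Thm. 7.15;
Milnor–Stasheff 1974, Appendix A): near `x`, all `localClassX o y` are restrictions of a single
class on a closed chart ball about `x` — the ball class of the oriented reference orientation
`μR o x` carried back along the chart at `x` (excision, cross-universe transport, excision), the
comparison at each `y` being the chart-change step `chartTransport_symm_μR`, whose positivity
hypothesis holds near `x` by the defining property of a smooth orientation (`det_pos_of_iff`).
[cite: MilnorStasheff1974, Appendix A] -/
theorem locallyConsistent_localClassX (x : X) :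
    ∃ K ∈ 𝓝 x, ∃ μK : localHomologyOfSet ℤ ℤ X K n,
      ∀ y (hy : y ∈ K), restrictToPoint ℤ ℤ hy n μK = localClassX o y := by
  have hxc : x ∈ (chartAt (𝔼 n) x).source := mem_chart_source _ x
  have hxt : chartAt (𝔼 n) x x ∈ (chartAt (𝔼 n) x).target := mem_chart_target _ x
  -- (1) local consistency of the oriented reference orientation at `c x`
  obtain ⟨KE, hKE, κ, hκ⟩ := (μR o x).locallyConsistent (chartAt (𝔼 n) x x)
  -- (2) the set where the orientation character is read off the Jacobian sign
  have hTn : {y : X | o y = o x ↔ 0 < LinearMap.det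
      ((tangentCoordChange (𝓡 n) y x y : 𝔼 n →L[ℝ] 𝔼 n) : 𝔼 n →ₗ[ℝ] 𝔼 n)} ∈ 𝓝 x :=
    o.eventually_eq_iff x
  -- (3) a closed chart ball inside everything
  have hN : KE ∩ ((chartAt (𝔼 n) x).target ∩ (chartAt (𝔼 n) x).symm ⁻¹'
      ({y : X | o y = o x ↔ 0 < LinearMap.det
        ((tangentCoordChange (𝓡 n) y x y : 𝔼 n →L[ℝ] 𝔼 n) : 𝔼 n →ₗ[ℝ] 𝔼 n)} ∩
          (chartAt (𝔼 n) x).source)) ∈ 𝓝 (chartAt (𝔼 n) x x) := by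
    refine inter_mem hKE (inter_mem (chart_target_mem_nhds _ x) ?_)
    refine ((chartAt (𝔼 n) x).continuousAt_symm hxt).preimage_mem_nhds ?_
    rw [(chartAt (𝔼 n) x).left_inv hxc]
    exact inter_mem hTn ((chartAt (𝔼 n) x).open_source.mem_nhds hxc)
  obtain ⟨ρ, hρ, hρN⟩ := Metric.nhds_basis_closedBall.mem_iff.1 hN
  have hK'KE : closedBall (chartAt (𝔼 n) x x) ρ ⊆ KE := fun v hv ↦ (hρN hv).1
  have hK't : closedBall (chartAt (𝔼 n) x x) ρ ⊆ (chartAt (𝔼 n) x).target :=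
    fun v hv ↦ (hρN hv).2.1
  have hK'T : ∀ v ∈ closedBall (chartAt (𝔼 n) x x) ρ,
      ((chartAt (𝔼 n) x).symm v ∈ {y : X | o y = o x ↔ 0 < LinearMap.det
        ((tangentCoordChange (𝓡 n) y x y : 𝔼 n →L[ℝ] 𝔼 n) : 𝔼 n →ₗ[ℝ] 𝔼 n)}) ∧
        (chartAt (𝔼 n) x).symm v ∈ (chartAt (𝔼 n) x).source := fun v hv ↦ (hρN hv).2.2
  -- (4) the sets of the transport chain
  have hV : IsOpen ((chartAt (𝔼 n) x) '' (chartAt (𝔼 n) x).source) :=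
    (chartAt (𝔼 n) x).isOpen_image_of_subset_source (chartAt (𝔼 n) x).open_source subset_rfl
  have hclK' : closure (closedBall (chartAt (𝔼 n) x x) ρ) ⊆
      (chartAt (𝔼 n) x) '' (chartAt (𝔼 n) x).source := by
    rw [isClosed_closedBall.closure_eq, (chartAt (𝔼 n) x).image_source_eq_target]
    exact hK't
  have heKU : (chartHomeo (chartAt (𝔼 n) x) subset_rfl) ''
      {u : ↥(chartAt (𝔼 n) x).source | chartAt (𝔼 n) x u ∈ closedBall (chartAt (𝔼 n) x x) ρ} ⊆
        Subtype.val ⁻¹' closedBall (chartAt (𝔼 n) x x) ρ := by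
    rintro _ ⟨u, hu, rfl⟩
    exact hu
  have hKXU : (Subtype.val ⁻¹' ((chartAt (𝔼 n) x).source ∩
      (chartAt (𝔼 n) x) ⁻¹' closedBall (chartAt (𝔼 n) x x) ρ) : Set ↥(chartAt (𝔼 n) x).source) ⊆
        {u : ↥(chartAt (𝔼 n) x).source | chartAt (𝔼 n) x u ∈ closedBall (chartAt (𝔼 n) x x) ρ} :=
    fun u hu ↦ hu.2
  have hKf : (chartAt (𝔼 n) x).source ∩ (chartAt (𝔼 n) x) ⁻¹' ball (chartAt (𝔼 n) x x) ρ ⊆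
      (chartAt (𝔼 n) x).source ∩ (chartAt (𝔼 n) x) ⁻¹' closedBall (chartAt (𝔼 n) x x) ρ :=
    fun y hy ↦ ⟨hy.1, ball_subset_closedBall hy.2⟩
  have hKfn : (chartAt (𝔼 n) x).source ∩ (chartAt (𝔼 n) x) ⁻¹' ball (chartAt (𝔼 n) x x) ρ ∈ 𝓝 x :=
    ((chartAt (𝔼 n) x).isOpen_inter_preimage isOpen_ball).mem_nhds ⟨hxc, mem_ball_self hρ⟩
  -- (5) the class
  refine ⟨(chartAt (𝔼 n) x).source ∩ (chartAt (𝔼 n) x) ⁻¹' ball (chartAt (𝔼 n) x x) ρ, hKfn,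
    restrictLocal ℤ ℤ hKf n
      (relativeSingularHomology.map ℤ ℤ (subsetIncl (chartAt (𝔼 n) x).source)
        (localHomologyOfSet.mapsTo_subsetIncl_compl _ _) n
        (restrictLocal ℤ ℤ hKXU n
          ((localHomologyOfSet.xEquiv ℤ ℤ (chartHomeo (chartAt (𝔼 n) x) subset_rfl)
            {u : ↥(chartAt (𝔼 n) x).source |
              chartAt (𝔼 n) x u ∈ closedBall (chartAt (𝔼 n) x x) ρ} n).symm
            (restrictLocal ℤ ℤ heKU n
              ((localHomologyOfSet.openSubsetIso ℤ ℤ hV hclK' n).inv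
                (restrictLocal ℤ ℤ hK'KE n κ)))))), fun y hy ↦ ?_⟩
  -- (6) unwinding the restrictions
  have hyU : y ∈ (chartAt (𝔼 n) x).source := hy.1
  have hyK' : chartAt (𝔼 n) x y ∈ closedBall (chartAt (𝔼 n) x x) ρ := ball_subset_closedBall hy.2
  have hyKU : (⟨y, hyU⟩ : ↥(chartAt (𝔼 n) x).source) ∈
      {u : ↥(chartAt (𝔼 n) x).source | chartAt (𝔼 n) x u ∈ closedBall (chartAt (𝔼 n) x x) ρ} :=
    hyK'
  rw [restrictToPoint_restrictLocal_apply,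
    restrictToPoint_map_subsetIncl (chartAt (𝔼 n) x).open_source ⟨y, hyU⟩ (hKf hy) n,
    restrictToPoint_restrictLocal_apply, ← xEquiv_symm_restrictToPoint _ hyKU,
    restrictToPoint_restrictLocal_apply,
    restrictToPoint_openSubsetIso_inv hV hclK' (chartHomeo (chartAt (𝔼 n) x) subset_rfl ⟨y, hyU⟩)
      hyK' n,
    restrictToPoint_restrictLocal_apply,
    hκ (chartHomeo (chartAt (𝔼 n) x) subset_rfl ⟨y, hyU⟩ : 𝔼 n) (hK'KE hyK')]
  -- (7) the chart-change step
  have hiff : o y = o x ↔ 0 < LinearMap.det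
      ((tangentCoordChange (𝓡 n) y x y : 𝔼 n →L[ℝ] 𝔼 n) : 𝔼 n →ₗ[ℝ] 𝔼 n) := by
    have h := (hK'T _ hyK').1
    rwa [(chartAt (𝔼 n) x).left_inv hyU] at h
  have key := chartTransport_symm_μR o x y hyU (det_pos_of_iff o hyU hiff)
  rw [localClassX, ← (LinearEquiv.eq_symm_apply _).2 key, chartTransport_symm_apply]
  rfl

/-- **The homological `ℤ`-orientation attached to a smooth orientation** `o` of a `C¹` manifold:
at `y`, the generator of `Hₙ(X | y; ℤ)` corresponding, through the preferred chart at `y`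
composed with the identity or the reflection `r` according as the chart is positively oriented or
not, to the reference generator of `Hₙ(ℝⁿ | ·; ℤ)` (Bredon, *Topology and Geometry* (1993), VI.7,
Prop. 7.14 and Thm. 7.15; Milnor–Stasheff, *Characteristic Classes* (1974), Appendix A,
pp. 122–123). [cite: MilnorStasheff1974, Appendix A] -/
def homologicalOrientationOfSmooth : HomologicalOrientation ℤ X n where
  localClass := localClassX o
  isGenerator y := by
    obtain ⟨e, he⟩ := (μR o y).isGenerator (chartAt (𝔼 n) y y)
    refine ⟨(chartTransport (chartAt (𝔼 n) y) (chartAt (𝔼 n) y).open_source subset_rfl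
      (mem_chart_source (𝔼 n) y) n).trans e, ?_⟩
    rw [localClassX, LinearEquiv.trans_apply, LinearEquiv.apply_symm_apply, he]
  locallyConsistent := locallyConsistent_localClassX o

end Assembly

end HomologicalOrientationOfSmooth

/-! ### The discharge -/

section Discharge

variable (X : Type u) [TopologicalSpace X] {n : ℕ} [ChartedSpace (𝔼 n) X] [IsManifold (𝓡 n) 1 X]

/-- **Discharge of `Literature.Topology.FourManifolds.isOrientableOver_int_of_isOrientable`**:
a smoothly orientable `C¹` manifold (in the sense of
`Literature.Topology.FourManifolds.IsOrientable`: a locally constant family of orientations of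
the tangent spaces read in the preferred charts) is `ℤ`-orientable in the homological sense
(`Literature.AlgebraicTopology.SingularHomology.IsOrientableOver`: a locally consistent family
of generators of `Hₙ(X | x; ℤ)`), for `X : Type u` in any universe and every `n`, exactly as the
fact is declared: over `[TopologicalSpace X] [ChartedSpace (𝔼 n) X] [IsManifold (𝓡 n) 1 X]` only
(the `Bridge` section of `IntersectionLattice.lean` also has `[T2Space X] [SecondCountableTopology X]`
in scope, but the `def` does not depend on them; neither does the proof — a charted space over `ℝⁿ`
is `T₁`, `ChartedSpace.t1Space`, which is all the point excisions need, and Hausdorffness is never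
used).
Bredon, *Topology and Geometry*, GTM 139 (1993), VI.7, Prop. 7.14 and Thm. 7.15; Milnor–Stasheff,
*Characteristic Classes* (1974), Appendix A, pp. 122–123 (the preferred generator
`μₓ ∈ Hₙ(M, M - x)` of an oriented manifold). Proof: `homologicalOrientationOfSmooth`.
[cite: MilnorStasheff1974, Appendix A] -/
theorem isOrientableOver_int_of_isOrientable_holds :
    isOrientableOver_int_of_isOrientable (n := n) X := fun h ↦ by
  haveI : T1Space X := ChartedSpace.t1Space (𝔼 n) X
  exact ⟨HomologicalOrientationOfSmooth.homologicalOrientationOfSmooth (Classical.choice h)⟩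

end Discharge

end Literature.Topology.FourManifolds
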